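import Summits.QuantumFields.YangMills.Theses.PencilRigidity
import Literature.Analysis.UnboundedOperators.HeatKernel
import Literature.MathematicalPhysics.QuantumFieldTheory.OSAxiomsFreeFieldKernelProofs
import Summits.QuantumFields.YangMills.Theorems.PencilRigidityCurvatureKernelBoundKernelPinning
import Literature.MathematicalPhysics.QuantumLattice.FreeCovarianceProofs

/-!
# Disproof of `PencilRigidity.CurvatureKernelBound` (stmt-QuantumFields-11687) — standing
# adversary's work file, PART II–III (cdisprove cycles 2–3, seats …-11687-g2-0 / …-11687-g3-0)

**Verdict so far: NO KILL.** The crux resists every cheap attack because every `W₁`-inhabitant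
anyone can CONSTRUCT today has its couplings `β_k` in the strong-coupling disc (or `β_k = 0`),
where the truncated plaquette correlations have range `O(a_k)` in physical units: on `⁰𝒮` they
vanish (kernel `K ≡ κ²`, conclusion holds with `η = 10`, §A') or, for `a_k log c_k ↛ 0`, blow up
(no limit, not an inhabitant). A substantive counterexample is a gapped Wilson continuum limit
whose renormalised `tr F²` two-point function has "dimension ≥ 5" in the precise sense of §B
(`s² S₂(F_s) ↛ 0` under `⁰𝒮`-dilations) or is discontinuous off `0` — i.e. an output of the open
UV construction (`Literature.Barriers.QuantumFields.UVStabilityNonUniqueness`), against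
asymptotic-freedom lore (`dim tr F² = 4`, `K ∼ |x|⁻⁸ log⁻²`, which passes §B with two powers of
room).

## Findings (all theorems below are sorry-free unless marked NEAR-MISS)

* **PART III lives in the companion workfile `DisproofIII.lean` (same directory; `ledger crux cat <item>
  DisproofIII.lean`) because this file would exceed the workfile size limit.** Its two headline theorems:
* §K  **(cycle 3) ORDER-INSUFFICIENCY WITH FULL EUCLIDEAN STRUCTURE, sorry-free** (in `DisproofIII.lean`):
  `GFF.not_axialGrowthOfEuclideanPackage` — even full `O(4)`-invariance on `⁰𝒮` and E2 in EVERY frame (all 16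
  mirrors, incl. the diagonal ones of `DiagonalMirrorRPR`) plus a continuous representing kernel do NOT bound the
  order: the dimension-5 generalised free field `K₅ = ∫_{μ>2} μ⁷ G_μ dμ` (RP inherited from the tree's
  `freeCovariance_reflectionPositive_holds`), via the generic `KernelWitness` pipeline. The order is pure UV input.
* §J  **(cycle 3) ORDER-INSUFFICIENCY WITH REGULARITY, sorry-free** (in `DisproofIII.lean`):
  `L1Witness.not_axialGrowthOfTwoPointPackage` — the two-point shadow of `W₁ ∖ lattice` (translations,
  proper signed permutations, swap, hermiticity, E2 on positive-time one-point families, exponential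
  clustering) PLUS a representing kernel continuous off `0` do NOT imply the axial growth bound of Stub E:
  witness `K = k₁(‖·‖₁)` with `e⁻² s⁻¹⁰ ≤ K(s e₀)`, `T` = Hahn–Banach extension of `∫ K F` from `⁰𝒮`
  (flat-decay lemma `norm_le_flat_of_isOffDiagonal` = the core of Stub A4), RP by an explicit sum of squares.
  LANDED so far (Negative lane): `Theorems/CurvatureKernelBound/Negative/Handles.lean` (p73086),
  `…/UVScaling.lean` (p73991); `Pinning`, `FreeKernel`, `OrderCore`, `Moment`, `Witness`, `L1*` follow.

* §A  handles: `KernelData`, `Represents`, `KernelConclusion`, `W1`, `curvatureKernelBound_iff`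
  (`Iff.rfl`), `kernelConclusion_iff`; §A' `kernelConclusion_of_const` (degenerate inhabitants).
* §B  **UV scaling test = the exact content of the bound.** `norm_two_point_dil_le`: a
  represented `S₁` obeys `‖S₁ 2 F_s‖ ≤ C s⁸(1 + s^(η-10) M)‖F‖₁` on dilates of a separated
  off-diagonal `F`; `tendsto_sq_mul_norm_two_point_dil`: hence `s² ‖S₁ 2 F_s‖ → 0`;
  `not_kernelConclusion_of_dilation_blowup`: **DISPROOF CRITERION** — any `W₁`-inhabitant with
  `s_j² ‖S₁ 2 F_{s_j}‖ ↛ 0` kills the crux; `dimension_threshold_of_curvatureKernelBound`: the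
  crux ⇒ this threshold for every inhabitant; `kernelData_rpow`, `integral_rpow_kernel_dil`:
  the rate is attained by `‖x‖^(η-10)` (tightness; `η = 0` is the forbidden `s⁻²`).
* §C  **pinning**: `kernel_eq_zero_off_origin`, `kernel_unique` (two continuous-off-0 kernels
  representing the same functional on `⁰𝒮` agree off `0`), `kernelConclusion_iff_of_represents`
  (the `∃ K` of the crux is a property of THE lattice-limit kernel: provers bound it, refuters
  read the counterexample off it).
* §F  free-field calibration (sorry-free): `FreeKernel.G_le`, `FreeKernel.G_ge`
  (`e^{-m‖x‖}/(4π²‖x‖²) ≤ G_m(x) ≤ 1/(4π²‖x‖²)` from the heat-kernel subordination integral by an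
  explicit primitive), `FreeKernel.abs_sq_mul_G_smul_sub_le` (`|s²G_m(sw) − (4π²‖w‖²)⁻¹| ≤ ms/(4π²‖w‖)`):
  the analytic input of the §D witnesses' scaling limit `s² T(F_s) → (4π²)⁻¹ ∫ ‖w‖⁻² 𝒟F`.
* §G  **order-insufficiency CORE (sorry-free)**: `norm_sq_integral_G_dil_sub_le`,
  `tendsto_sq_mul_integral_G_dil` (`s_j² ∫ G_m(s_j w) Ψ → ∫ (4π²‖w‖²)⁻¹ Ψ` on separated supports),
  `not_representable_of_masslessMoment_ne_zero`: ANY functional `T F = ∫ G_m(u₀-u₁)(L F)(u) du`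
  with `L` of dilation degree `-8` and support-preserving has NO kernel with the crux's bound as
  soon as one massless moment `∫ (4π²‖u₀-u₁‖²)⁻¹ (L F₀) ≠ 0`; §G' `L8 = Σ_μ ∂_{(0,μ)}⁸` with
  `L8_dil`, `L8_supp`, `not_representable_T0_L8` — the §D witness reduced to ONE number
  (`Σ_μ ∂_μ⁸‖w‖⁻²(e₁) = 483840`) + the existence of `T₀` as a CLM + its package properties.
* §G'' the numbers `d⁸/dt⁸(1+t²)⁻¹|₀ = 40320`, `d⁸/dt⁸(1+t)⁻²|₀ = 362880` (sorry-free).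
* §H–§H'' **residue R2 discharged (sorry-free)**: Schwartz IBP ×8 (`integral_mul_iteratedLineDerivOp_const`),
  line restriction (`iteratedDeriv_line`), the cut-off massless weight `LamS` with
  `H8_basePt : (Σ_μ ∂_{(0,μ)}⁸ ΛS)(e₁,0) = 483840/(4π²)`, and `exists_masslessMoment_L8_ne_zero`
  (bump tensor at `(e₁,0)`).
* §I  **residue R1 discharged (sorry-free)**: `T0` — the free two-point functional
  `F ↦ ∫ G_m(u₀-u₁)F` IS a CLM on `𝓢((ℝ⁴)²)` (`integrable_G_mul_weight` by Fubini through
  `finTwoArrow`, seminorm bound `T0const m · semi5`), `TL8 := T0 ∘ L8`, and the UNCONDITIONAL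
  `TL8_not_representable` (axioms: propext, Classical.choice, Quot.sound): the two-point function of
  the Gaussian family with covariance `(Σ_μ k_μ⁸)/(k²+m²)` has NO kernel with the crux's bound.
* §D  NEAR-MISSES (sorried, blueprints in the docstrings): `not_curvatureKernelBound_without_lattice`
  — the OS package of `W₁` (E0–E4, E0', translations, proper signed permutations, gap; even with
  16-mirror RP added) does NOT imply the conclusion: Gaussian witnesses `Ĉ(k) = (Σ_μ k_μ⁸)/(k²+m²)`
  (axis-RP, `W(B₄)`, gap `m`, kernel `∼ |x|⁻¹⁰`, `p₈(∂)|x|⁻²(e₁) = 483840 ≠ 0`) and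
  `Ĉ(k) = (Σ_μ k_μ⁴)²/(k²+m²)` (RP across all 16 mirrors, `(p₄(∂))²|x|⁻²(e₁) = 940032 ≠ 0`);
  obstruction = no `⁰𝒮`-package (E0', finite-list E2, E4, all-`n` gap) for Gaussian families in
  the tree. `TwoPointOrderInsufficiency` — its two-point-level shadow (provable; next target).

## Part I (cycle 1, seat refuter-cdisprove-…-11687-0) — NOT readable from worker jails
Evidence on the item (`ledger workitem get stmt-QuantumFields-11687`): `20260815T232309Z-Disproof.lean`
(v4, 2425 lines, rc0, sha affc67ac…), standalone `TwoPointLevel.lean` (1402 lines, 0 sorries),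
landing-ready `NegBetaZeroA.lean` / `NegBetaZeroB.lean`. Its theorems (names as recorded there):
* β ≡ 0 ultralocality: `wilsonMeasure_zero`, `integral_update_torusPlaquette`, `exists_free_bond`,
  `integral_torusPlaq_mul`, `integral_torusDensity_mul`, `latticeSchwinger_two_eq_mul_of_beta_zero`
  (EXACT finite-`k` factorisation of the curvature two-point lattice function on real tensors with
  `f₀f₁ ≡ 0` when `β_k = 0`, any `a_k, c_k, m_k`), `twoPoint_eq_mul_of_beta_zero`,
  `W1_twoPoint_eq_mul_of_beta_zero` (`∃ᶠ β_k = 0` ⇒ `S₁2(f⊗g) = S₁1 f · S₁1 g` on `⁰𝒮` ⇒ constant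
  kernel ⇒ crux holds: NO counterexample at `β ≡ 0`).
* pinning (re-proved here as §C): `kernel_eq_zero_of_integral_eq_zero`, `kernel_unique`,
  `bound_of_represents_of_kernelData`.
* `AxisCross.twoPoint_package_insufficient`: a two-point functional with translations, ALL signed
  permutations, hermiticity, RP on positive-time families, exact `e^{-t}` clustering, nonzero on
  `⁰𝒮`, and NO kernel continuous off `0` (supported on the axis cross) — the `S₁`-side package of
  `W₁` (axis mirrors only) carries no kernel regularity at all.
* NEAR-MISS there: full-package `¬ CurvatureKernelBoundWithoutLattice` (same obstruction as §D).

## Regimes tried (cycles 1–2) and why none yields a counterexample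
| regime | status |
|---|---|
| `β_k = 0` (frequently) | exact factorisation ⇒ `K ≡ κ²` (Part I) — crux TRUE there |
| `0 < |β_k| ≤ β₀` (OS78 disc), `a_k log|c_k| → 0` | truncated part `≲ c_k² e^{-m d/a_k} → 0` on `d`-separated tensors ⇒ `K ≡ κ²` |
| same, `limsup a_k log|c_k| > 0` | two-point lattice function diverges on close supports ⇒ `W₁.1` fails (not an inhabitant; lower bound needs the cluster expansion's leading term) |
| `β_k → 0` | lattice mass `−4 log β_k → ∞`: even more ultralocal |
| `β_k < 0` | nothing new (`|β|` small: same disc; else unconstructed) |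
| `β_k → ∞`, `liminf a_k ξ(β_k) > 0` | the genuine continuum limit: `HasLatticeMassGap` = volume-uniform clustering of ALL gauge-invariant observables at weak coupling = the open problem |
| bulk transitions (SU(N≥4) fundamental, mixed actions via `r.ρ ⊇ adjoint`) | first order (finite ξ) or mean-field endpoints (scalar of dim 1–2: bound holds); none constructed |
| finite / abelian `G` | excluded by `IsSimpleCompactGroup` (connected, non-abelian) |
| typing: `0⁻¹`, `K 0`, rpow at `0`, touching supports, non-tensor `⁰𝒮`, `L_k` small, trivial summands in `ρ` | no loophole (read-back in the seat's NOTES.md) |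

## For provers (briefing)
* The conclusion is equivalent to a bound on THE kernel (§C); its whole content is the UV
  scaling `s² S₂(F_s) → 0` plus local boundedness/continuity off `0` (§B); `η` may be taken `≤ 10`
  w.l.o.g. only after establishing boundedness at infinity (clustering gives it).
* Every lattice-side `C⁺` must be stated `c_k`-free or inside the branch `liminf a_k ξ_k > 0`
  (triage G2): `W₁` allows `c_k = a_k⁻⁵` at `β ≡ 0` (crux true, uniform lattice kernel bounds false).
* Model-blind stubs must type the kernel `ℂ`-valued (triage G1) and cannot assert any ORDER (§D).
* AVERAGING GAP (for the axis-only lines 2/3/6; blueprint, checked by exponent count): the kernel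
  `K_{b,c}(x) = Σ_μ ∫₀^∞ λ^c e^{-λ|x_μ|} Π_{ν≠μ} λ^b e^{-λ^b |x_ν|} dλ` with `(b,c) = (2,3)` is
  continuous off `0`, `W(B₄)`-invariant, OS-positive across all FOUR axis mirrors (each term is a
  Laplace transform in `x_μ` times 1D kernels `e^{-κ|s|}`, which are both PD and RP), bounded with
  all moments at infinity, has POINTWISE order ten on the axis (`K(r e₀) = Γ(10) r⁻¹⁰ (1+o(1))`,
  `η = 0`: violates the crux) but its AVERAGES over the balls `B(r e₀, r/4)` are `≍ r⁻⁷` (`η = 3`):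
  smeared / block-averaged lattice order bounds at resolution comparable to the separation do NOT
  give the pointwise order without a Harnack-type input (diagonal RP fails for `K_{b,c}`, so the
  sixteen-chart lines are not hit by it).
-/

open scoped BigOperators Topology SchwartzMap
open MeasureTheory Filter Set
open Literature.MathematicalPhysics.QuantumLattice Literature.MathematicalPhysics.AQFT
  Literature.MathematicalPhysics.QuantumFieldTheory

noncomputable section

namespace Summit.QuantumFields.YangMills.Cruxes.CurvatureKernelBound.Disproof

/-- `ℝ⁴` as in the route file. -/
abbrev E4 : Type := EuclideanSpace ℝ (Fin 4)

/-- `dim (ℝ⁴)² = 8`. -/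
theorem finrank_config : Module.finrank ℝ (Fin 2 → E4) = 8 := by
  simp [Module.finrank_pi_fintype]

example : (volume : Measure (Fin 2 → E4)).IsAddHaarMeasure := inferInstance

/-- Lebesgue measure on `(ℝ⁴)²` has temperate growth (instance supplied by name; inference from
`IsAddHaarMeasure` does not fire on the `Pi` measure space). -/
instance hasTemperateGrowth_config : (volume : Measure (Fin 2 → E4)).HasTemperateGrowth :=
  Measure.IsAddHaarMeasure.instHasTemperateGrowth

/-! ## §A Handles -/

/-- The kernel data `(K, C, η)` asked for by the conclusion of the crux (verbatim clauses). -/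
def KernelData (K : E4 → ℝ) (C η : ℝ) : Prop :=
  0 < η ∧ ContinuousOn K {x : E4 | x ≠ 0} ∧ ∀ x : E4, x ≠ 0 → |K x| ≤ C * (1 + ‖x‖ ^ (η - 10))

/-- Two-point functionals (the level at which everything below is stated). -/
abbrev TwoPointCLM : Type := 𝓢((Fin 2 → E4), ℂ) →L[ℂ] ℂ

/-- `K` represents the two-point functional `T` on `⁰𝒮` (verbatim last clause of the crux). -/
def RepresentsCLM (T : TwoPointCLM) (K : E4 → ℝ) : Prop :=
  ∀ F : 𝓢((Fin 2 → E4), ℂ), IsOffDiagonal F →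
    Integrable (fun x : Fin 2 → E4 => (K (x 0 - x 1) : ℂ) * F x) ∧
      T F = ∫ x : Fin 2 → E4, (K (x 0 - x 1) : ℂ) * F x

/-- `K` represents the two-point function of the family `S₁` on `⁰𝒮`. -/
abbrev Represents (S₁ : SchwingerFamily E4) (K : E4 → ℝ) : Prop := RepresentsCLM (S₁ 2) K

/-- The conclusion of the crux for a one-species family `S₁` (verbatim). -/
def KernelConclusion (S₁ : SchwingerFamily E4) : Prop :=
  ∃ (K : E4 → ℝ) (C η : ℝ), 0 < η ∧ ContinuousOn K {x : E4 | x ≠ 0} ∧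
    (∀ x : E4, x ≠ 0 → |K x| ≤ C * (1 + ‖x‖ ^ (η - 10))) ∧
    ∀ F : SchwartzMap (Fin 2 → E4) ℂ, IsOffDiagonal F →
      MeasureTheory.Integrable (fun x : Fin 2 → E4 => (K (x 0 - x 1) : ℂ) * F x) ∧
        S₁ 2 F = ∫ x : Fin 2 → E4, (K (x 0 - x 1) : ℂ) * F x

theorem kernelConclusion_iff (S₁ : SchwingerFamily E4) :
    KernelConclusion S₁ ↔ ∃ (K : E4 → ℝ) (C η : ℝ), KernelData K C η ∧ Represents S₁ K := by
  constructor
  · rintro ⟨K, C, η, hη, hc, hb, hr⟩; exact ⟨K, C, η, ⟨hη, hc, hb⟩, hr⟩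
  · rintro ⟨K, C, η, ⟨hη, hc, hb⟩, hr⟩; exact ⟨K, C, η, hη, hc, hb, hr⟩

/-- The curvature package `W₁ r sch S₁` of the crux (verbatim `let W₁ := …` body). -/
def W1 (G : Type) [Group G] [TopologicalSpace G] [IsTopologicalGroup G] [CompactSpace G]
    [MeasurableSpace G] [BorelSpace G]
    (r : LatticeRep G) (sch : SpeciesScheme (YMSpecies G)) (S₁ : SchwingerFamily E4) : Prop :=
  (∀ (n : ℕ), n ≠ 0 → ∀ (f : Fin n → SchwartzMap E4 ℝ) (F : SchwartzMap (Fin n → E4) ℂ),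
      IsTensorOf F (fun i => ofRealTest (f i)) → IsOffDiagonal F →
        Filter.Tendsto (fun k : ℕ => ((latticeSchwinger r.ρ sch (fun s => s.F) k n
          (fun _ => r.curvature) f : ℝ) : ℂ)) Filter.atTop (nhds (S₁ n F))) ∧
    (S₁.toLabelled.IsNormalized ∧ S₁.toLabelled.IsHermitian ∧ S₁.toLabelled.HasLinearGrowth ∧
      S₁.toLabelled.IsReflectionPositive ∧ S₁.toLabelled.IsSymmetric ∧
        S₁.toLabelled.HasClusterProperty) ∧
    (∀ (n : ℕ) (a : E4) (F : SchwartzMap (Fin n → E4) ℂ), IsOffDiagonal F →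
      S₁ n (translateMulti a F) = S₁ n F) ∧
    (∀ (R : E4 ≃ₗᵢ[ℝ] E4), LinearMap.det (R.toLinearEquiv : E4 →ₗ[ℝ] E4) = 1 →
      (∀ i : Fin 4, ∃ j : Fin 4, R (EuclideanSpace.single i 1) = EuclideanSpace.single j 1 ∨
        R (EuclideanSpace.single i 1) = -EuclideanSpace.single j 1) →
      ∀ (n : ℕ) (F : SchwartzMap (Fin n → E4) ℂ), IsOffDiagonal F →
        S₁ n (linActMulti R F) = S₁ n F) ∧
    (∃ Δ : ℝ, 0 < Δ ∧ S₁.toLabelled.HasMassGap Δ ∧ HasLatticeMassGap r sch Δ)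

/-- The crux, unfolded: `W₁ ⇒ KernelConclusion` for every compact simple `G`, `r`, `sch`, `S₁`. -/
theorem curvatureKernelBound_iff :
    Summit.QuantumFields.YangMills.Theses.PencilRigidity.CurvatureKernelBound ↔
      ∀ (G : Type) [Group G] [TopologicalSpace G] [IsTopologicalGroup G] [CompactSpace G],
        IsCompactSimpleLieGroup G →
          letI : MeasurableSpace G := borel G
          haveI : BorelSpace G := ⟨rfl⟩
          ∀ (r : LatticeRep G) (sch : SpeciesScheme (YMSpecies G)) (S₁ : SchwingerFamily E4),
            W1 G r sch S₁ → KernelConclusion S₁ :=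
  Iff.rfl

/-! ## §A' Degenerate inhabitants satisfy the conclusion -/

/-- A family whose two-point function on `⁰𝒮` is `κ ∫ F` (zero scheme: `κ = 0`; ultralocal /
constant-field limits: `κ = (one-point constant)²`) satisfies the conclusion with `K ≡ κ`,
`C = |κ|`, `η = 10`. -/
theorem kernelConclusion_of_const (S₁ : SchwingerFamily E4) (κ : ℝ)
    (h : ∀ F : 𝓢((Fin 2 → E4), ℂ), IsOffDiagonal F → S₁ 2 F = (κ : ℂ) * ∫ x : Fin 2 → E4, F x) :
    KernelConclusion S₁ := by
  refine ⟨fun _ => κ, |κ|, 10, by norm_num, continuousOn_const, fun x _ => ?_, fun F hF => ⟨?_, ?_⟩⟩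
  · norm_num
    linarith [abs_nonneg κ]
  · exact (F.integrable.const_mul (κ : ℂ))
  · rw [h F hF, ← integral_const_mul]

/-! ## §B The UV scaling test (dimension-5 threshold) -/

/-- Dilation of two-point test functions: `(dil s hs F) x = F (s⁻¹ • x)`. -/
abbrev dil (s : ℝ) (hs : s ≠ 0) : 𝓢((Fin 2 → E4), ℂ) →L[ℂ] 𝓢((Fin 2 → E4), ℂ) :=
  dilateTest s hs

theorem dil_apply (s : ℝ) (hs : s ≠ 0) (F : 𝓢((Fin 2 → E4), ℂ)) (x : Fin 2 → E4) :
    dil s hs F x = F (s⁻¹ • x) := rfl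



/-- `⁰𝒮` is dilation invariant. -/
theorem isOffDiagonal_dil {s : ℝ} (hs : s ≠ 0) {F : 𝓢((Fin 2 → E4), ℂ)} (hF : IsOffDiagonal F) :
    IsOffDiagonal (dil s hs F) := by
  intro x hx k
  have hL : ((dil s hs F : 𝓢((Fin 2 → E4), ℂ)) : (Fin 2 → E4) → ℂ) =
      (F : (Fin 2 → E4) → ℂ) ∘ (s⁻¹ • ContinuousLinearMap.id ℝ (Fin 2 → E4)) := by
    funext y; simp
  have hx' : (s⁻¹ • ContinuousLinearMap.id ℝ (Fin 2 → E4)) x ∈ coincidenceLocus 2 E4 := by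
    obtain ⟨i, j, hij, hxij⟩ := hx
    exact ⟨i, j, hij, by simp [hxij]⟩
  rw [hL, ContinuousLinearMap.iteratedFDeriv_comp_right _ (F.smooth _) x (i := k) le_rfl,
    hF _ hx' k]
  ext; simp

/-- Change of variables under dilation of the test function. -/
theorem integral_kernel_dil (K : E4 → ℝ) (F : 𝓢((Fin 2 → E4), ℂ)) {s : ℝ} (hs : 0 < s) :
    ∫ x : Fin 2 → E4, (K (x 0 - x 1) : ℂ) * dil s hs.ne' F x =
      (s ^ 8 : ℝ) • ∫ u : Fin 2 → E4, (K (s • (u 0 - u 1)) : ℂ) * F u := by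
  have h := Measure.integral_comp_inv_smul_of_nonneg (volume : Measure (Fin 2 → E4))
    (fun u : Fin 2 → E4 => (K (s • (u 0 - u 1)) : ℂ) * F u) hs.le
  rw [finrank_config] at h
  rw [← h]
  congr 1; funext x
  simp [smul_sub, smul_inv_smul₀ hs.ne']

/-- The constant of a kernel datum is non-negative. -/
theorem KernelData.C_nonneg {K : E4 → ℝ} {C η : ℝ} (h : KernelData K C η) : 0 ≤ C := by
  obtain ⟨-, -, hb⟩ := h
  have hx : (EuclideanSpace.single (0 : Fin 4) (1 : ℝ) : E4) ≠ 0 := by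
    intro h0; have := congrArg (fun v : E4 => v 0) h0; simp at this
  have h1 := hb _ hx
  have hpos : 0 < 1 + ‖(EuclideanSpace.single (0 : Fin 4) (1 : ℝ) : E4)‖ ^ (η - 10) := by positivity
  by_contra hC
  have := mul_neg_of_neg_of_pos (lt_of_not_ge hC) hpos
  linarith [abs_nonneg (K (EuclideanSpace.single (0 : Fin 4) (1 : ℝ)))]

/-- **UV scaling bound.** If `K` represents `S₁ 2` on `⁰𝒮` with the crux's bound, then on the
dilates `F(·/s)` of an off-diagonal `F` whose support has `δ ≤ ‖x₀ - x₁‖ ≤ R`,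
`‖S₁ 2 F_s‖ ≤ C s⁸ (1 + s^(η-10) max(δ^(η-10), R^(η-10))) ‖F‖_{L¹}` for every `s > 0`. -/
theorem norm_two_point_dil_le {T : TwoPointCLM} {K : E4 → ℝ} {C η : ℝ}
    (hrep : RepresentsCLM T K) (hK : KernelData K C η)
    {F : 𝓢((Fin 2 → E4), ℂ)} (hF : IsOffDiagonal F) {δ R : ℝ} (hδ : 0 < δ)
    (hsep : ∀ x, F x ≠ 0 → δ ≤ ‖x 0 - x 1‖ ∧ ‖x 0 - x 1‖ ≤ R) {s : ℝ} (hs : 0 < s) :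
    ‖T (dil s hs.ne' F)‖ ≤
      C * s ^ 8 * (1 + s ^ (η - 10) * max (δ ^ (η - 10)) (R ^ (η - 10))) * ∫ u, ‖F u‖ := by
  set M := max (δ ^ (η - 10)) (R ^ (η - 10)) with hM
  have hC := hK.C_nonneg
  obtain ⟨hη, hcont, hb⟩ := hK
  obtain ⟨-, hSF⟩ := hrep (dil s hs.ne' F) (isOffDiagonal_dil hs.ne' hF)
  rw [hSF, integral_kernel_dil K F hs, norm_smul, Real.norm_of_nonneg (by positivity)]
  have hpt : ∀ u : Fin 2 → E4,
      ‖(K (s • (u 0 - u 1)) : ℂ) * F u‖ ≤ C * (1 + s ^ (η - 10) * M) * ‖F u‖ := by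
    intro u
    by_cases hu : F u = 0
    · simp [hu]
    obtain ⟨h1, h2⟩ := hsep u hu
    have hw : u 0 - u 1 ≠ 0 := by
      intro h0; rw [h0, norm_zero] at h1; linarith
    have hsw : s • (u 0 - u 1) ≠ 0 := smul_ne_zero hs.ne' hw
    have hKb := hb _ hsw
    rw [norm_mul, Complex.norm_real, Real.norm_eq_abs]
    refine mul_le_mul_of_nonneg_right (hKb.trans ?_) (norm_nonneg _)
    rw [norm_smul, Real.norm_of_nonneg hs.le, Real.mul_rpow hs.le (norm_nonneg _)]
    have hwM : ‖u 0 - u 1‖ ^ (η - 10) ≤ M := by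
      rcases le_or_gt 0 (η - 10) with hpos | hneg
      · exact (Real.rpow_le_rpow (norm_nonneg _) h2 hpos).trans (le_max_right _ _)
      · exact (Real.rpow_le_rpow_of_nonpos hδ h1 hneg.le).trans (le_max_left _ _)
    have hsn : 0 ≤ s ^ (η - 10) := Real.rpow_nonneg hs.le _
    gcongr
  have hint : Integrable (fun u : Fin 2 → E4 => C * (1 + s ^ (η - 10) * M) * ‖F u‖) :=
    (F.integrable.norm.const_mul _)
  calc s ^ 8 * ‖∫ u, (K (s • (u 0 - u 1)) : ℂ) * F u‖
      ≤ s ^ 8 * ∫ u, ‖(K (s • (u 0 - u 1)) : ℂ) * F u‖ := by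
        gcongr; exact norm_integral_le_integral_norm _
    _ ≤ s ^ 8 * ∫ u, C * (1 + s ^ (η - 10) * M) * ‖F u‖ :=
        mul_le_mul_of_nonneg_left (integral_mono_of_nonneg
          (Eventually.of_forall fun _ => norm_nonneg _) hint (Eventually.of_forall hpt))
          (by positivity)
    _ = C * s ^ 8 * (1 + s ^ (η - 10) * M) * ∫ u, ‖F u‖ := by
        rw [integral_const_mul]; ring

/-- **Dimension-5 threshold.** Under the conclusion of the crux, `s² ‖S₁ 2 F_s‖ → 0` along every
sequence of scales `s_j → 0⁺`, for every off-diagonal `F` with `δ ≤ ‖x₀ - x₁‖ ≤ R` on its support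
(the two-point function of `tr F²` has "dimension < 5" on `⁰𝒮`-dilations). -/
theorem tendsto_sq_mul_norm_two_point_dil {T : TwoPointCLM} {K : E4 → ℝ} {C η : ℝ}
    (hrep : RepresentsCLM T K) (hK : KernelData K C η)
    {F : 𝓢((Fin 2 → E4), ℂ)} (hF : IsOffDiagonal F) {δ R : ℝ} (hδ : 0 < δ)
    (hsep : ∀ x, F x ≠ 0 → δ ≤ ‖x 0 - x 1‖ ∧ ‖x 0 - x 1‖ ≤ R)
    {s : ℕ → ℝ} (hs : ∀ j, 0 < s j) (hs0 : Tendsto s atTop (𝓝 0)) :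
    Tendsto (fun j => s j ^ 2 * ‖T (dil (s j) (hs j).ne' F)‖) atTop (𝓝 0) := by
  set M := max (δ ^ (η - 10)) (R ^ (η - 10)) with hM
  set I := ∫ u : Fin 2 → E4, ‖F u‖ with hI
  have hη := hK.1
  have hC := hK.C_nonneg
  have hI0 : 0 ≤ I := integral_nonneg fun _ => norm_nonneg _
  have hbound : ∀ j, s j ^ 2 * ‖T (dil (s j) (hs j).ne' F)‖ ≤
      C * I * (s j ^ 10 + s j ^ η * M) := by
    intro j
    have h := norm_two_point_dil_le hrep hK hF hδ hsep (hs j)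
    have hsj := hs j
    have hpow : s j ^ 2 * s j ^ 8 * s j ^ (η - 10) = s j ^ η := by
      rw [← pow_add, ← Real.rpow_natCast, ← Real.rpow_add hsj]
      norm_num
    calc s j ^ 2 * ‖T (dil (s j) (hs j).ne' F)‖
        ≤ s j ^ 2 * (C * s j ^ 8 * (1 + s j ^ (η - 10) * M) * I) := by gcongr
      _ = C * I * (s j ^ 10 + s j ^ 2 * s j ^ 8 * s j ^ (η - 10) * M) := by ring
      _ = C * I * (s j ^ 10 + s j ^ η * M) := by rw [hpow]
  have hlim : Tendsto (fun j => C * I * (s j ^ 10 + s j ^ η * M)) atTop (𝓝 0) := by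
    have h10 : Tendsto (fun j => s j ^ 10) atTop (𝓝 0) := by simpa using hs0.pow 10
    have hη' : Tendsto (fun j => s j ^ η) atTop (𝓝 0) := by
      have := hs0.rpow_const (p := η) (Or.inr hη.le)
      simpa [Real.zero_rpow hη.ne'] using this
    have : Tendsto (fun j => C * I * (s j ^ 10 + s j ^ η * M)) atTop
        (𝓝 (C * I * (0 + 0 * M))) :=
      tendsto_const_nhds.mul (h10.add (hη'.mul tendsto_const_nhds))
    simpa using this
  exact squeeze_zero (fun j => by positivity) hbound hlim

/-- **Disproof criterion (cdisprove).** A one-species family whose two-point function on some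
off-diagonal `F` is NOT `o(s⁻²)` along some sequence of dilations `s_j → 0⁺` violates the
conclusion of the crux: a counterexample to `CurvatureKernelBound` is exactly a `W₁`-inhabitant
whose `tr F²` two-point function has dimension `≥ 5` on `⁰𝒮` (or no kernel at all). -/
theorem not_representsCLM_of_dilation_blowup (T : TwoPointCLM)
    {F : 𝓢((Fin 2 → E4), ℂ)} (hF : IsOffDiagonal F) {δ R : ℝ} (hδ : 0 < δ)
    (hsep : ∀ x, F x ≠ 0 → δ ≤ ‖x 0 - x 1‖ ∧ ‖x 0 - x 1‖ ≤ R)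
    {s : ℕ → ℝ} (hs : ∀ j, 0 < s j) (hs0 : Tendsto s atTop (𝓝 0))
    (hblow : ¬ Tendsto (fun j => s j ^ 2 * ‖T (dil (s j) (hs j).ne' F)‖) atTop (𝓝 0)) :
    ¬ ∃ (K : E4 → ℝ) (C η : ℝ), KernelData K C η ∧ RepresentsCLM T K := by
  rintro ⟨K, C, η, hK, hrep⟩
  exact hblow (tendsto_sq_mul_norm_two_point_dil hrep hK hF hδ hsep hs hs0)

/-- Family version of the disproof criterion. -/
theorem not_kernelConclusion_of_dilation_blowup (S₁ : SchwingerFamily E4)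
    {F : 𝓢((Fin 2 → E4), ℂ)} (hF : IsOffDiagonal F) {δ R : ℝ} (hδ : 0 < δ)
    (hsep : ∀ x, F x ≠ 0 → δ ≤ ‖x 0 - x 1‖ ∧ ‖x 0 - x 1‖ ≤ R)
    {s : ℕ → ℝ} (hs : ∀ j, 0 < s j) (hs0 : Tendsto s atTop (𝓝 0))
    (hblow : ¬ Tendsto (fun j => s j ^ 2 * ‖S₁ 2 (dil (s j) (hs j).ne' F)‖) atTop (𝓝 0)) :
    ¬ KernelConclusion S₁ := by
  rw [kernelConclusion_iff]
  exact not_representsCLM_of_dilation_blowup (S₁ 2) hF hδ hsep hs hs0 hblow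

/-- The crux ⇒ the dimension-5 threshold for every `W₁`-inhabitant. -/
theorem dimension_threshold_of_curvatureKernelBound
    (h : Summit.QuantumFields.YangMills.Theses.PencilRigidity.CurvatureKernelBound)
    (G : Type) [Group G] [TopologicalSpace G] [IsTopologicalGroup G] [CompactSpace G]
    (hG : IsCompactSimpleLieGroup G) :
    letI : MeasurableSpace G := borel G
    haveI : BorelSpace G := ⟨rfl⟩
    ∀ (r : LatticeRep G) (sch : SpeciesScheme (YMSpecies G)) (S₁ : SchwingerFamily E4),
      W1 G r sch S₁ → ∀ (F : 𝓢((Fin 2 → E4), ℂ)), IsOffDiagonal F → ∀ (δ R : ℝ), 0 < δ →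
        (∀ x, F x ≠ 0 → δ ≤ ‖x 0 - x 1‖ ∧ ‖x 0 - x 1‖ ≤ R) →
        ∀ (s : ℕ → ℝ) (hs : ∀ j, 0 < s j), Tendsto s atTop (𝓝 0) →
          Tendsto (fun j => s j ^ 2 * ‖S₁ 2 (dil (s j) (hs j).ne' F)‖) atTop (𝓝 0) := by
  intro r sch S₁ hW F hF δ R hδ hsep s hs hs0
  obtain ⟨K, C, η, hK, hrep⟩ :=
    (kernelConclusion_iff S₁).1 (curvatureKernelBound_iff.1 h G hG r sch S₁ hW)
  exact tendsto_sq_mul_norm_two_point_dil hrep hK hF hδ hsep hs hs0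

/-- **Tightness of the rate.** The power kernels `‖x‖^(η-10)` are kernel data with `C = 1` … -/
theorem kernelData_rpow {η : ℝ} (hη : 0 < η) : KernelData (fun x : E4 => ‖x‖ ^ (η - 10)) 1 η := by
  refine ⟨hη, ?_, fun x hx => ?_⟩
  · exact ContinuousOn.rpow_const continuous_norm.continuousOn
      (fun x hx => Or.inl (norm_ne_zero_iff.2 hx))
  · rw [abs_of_nonneg (Real.rpow_nonneg (norm_nonneg _) _)]
    linarith [Real.rpow_nonneg (norm_nonneg x) (η - 10)]

/-- … and a power kernel `‖x‖^p` scales EXACTLY like `s^(8+p)` under dilation (`p = η - 10`: the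
rate `s^(η-2)` of `norm_two_point_dil_le` is attained; `p = -10`: the forbidden rate `s⁻²`). -/
theorem integral_rpow_kernel_dil (p : ℝ) (F : 𝓢((Fin 2 → E4), ℂ)) {s : ℝ} (hs : 0 < s) :
    ∫ x : Fin 2 → E4, ((‖x 0 - x 1‖ ^ p : ℝ) : ℂ) * dil s hs.ne' F x =
      (s ^ 8 * s ^ p : ℝ) • ∫ u : Fin 2 → E4, ((‖u 0 - u 1‖ ^ p : ℝ) : ℂ) * F u := by
  rw [integral_kernel_dil (fun x : E4 => ‖x‖ ^ p) F hs, mul_smul]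
  congr 1
  rw [← integral_smul]
  congr 1; funext u
  beta_reduce
  rw [norm_smul, Real.norm_of_nonneg hs.le, Real.mul_rpow hs.le (norm_nonneg _),
    Complex.real_smul]
  push_cast
  ring


/-! ## §C Pinning: the kernel of the conclusion is THE two-point kernel -/

section Pinning

/-- The real bump `x ↦ b x` as a complex-valued Schwartz function. -/
def bumpSchwartz {c : E4} (b : ContDiffBump c) : 𝓢(E4, ℂ) :=
  (b.hasCompactSupport.comp_left Complex.ofReal_zero).toSchwartzMap
    (Complex.ofRealCLM.contDiff.comp b.contDiff)

@[simp] theorem bumpSchwartz_apply {c : E4} (b : ContDiffBump c) (x : E4) :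
    bumpSchwartz b x = ((b x : ℝ) : ℂ) := rfl

/-- The two-point tensor `g ⊗ h` of two bumps. -/
def bumpTensor {c₀ c₁ : E4} (g : ContDiffBump c₀) (h : ContDiffBump c₁) : 𝓢((Fin 2 → E4), ℂ) :=
  SchwartzMap.tensorFin 2 ![bumpSchwartz g, bumpSchwartz h]

theorem bumpTensor_apply {c₀ c₁ : E4} (g : ContDiffBump c₀) (h : ContDiffBump c₁)
    (x : Fin 2 → E4) : bumpTensor g h x = ((g (x 0) * h (x 1) : ℝ) : ℂ) := by
  simp [bumpTensor, Fin.prod_univ_two]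

/-- Supports of the two bumps at distance: the tensor is off-diagonal. -/
theorem isOffDiagonal_bumpTensor {c₀ c₁ : E4} (g : ContDiffBump c₀) (h : ContDiffBump c₁)
    (hsep : g.rOut + h.rOut < ‖c₀ - c₁‖) : IsOffDiagonal (bumpTensor g h) := by
  refine IsOffDiagonal.of_tsupport_subset ?_
  -- the closed set containing the support
  let S : Set (Fin 2 → E4) := {x | x 0 ∈ Metric.closedBall c₀ g.rOut ∧ x 1 ∈ Metric.closedBall c₁ h.rOut}
  have hS : IsClosed S := by
    have h0 : Continuous fun x : Fin 2 → E4 => x 0 := continuous_apply 0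
    have h1 : Continuous fun x : Fin 2 → E4 => x 1 := continuous_apply 1
    exact (Metric.isClosed_closedBall.preimage h0).inter (Metric.isClosed_closedBall.preimage h1)
  have hsub : Function.support (bumpTensor g h : (Fin 2 → E4) → ℂ) ⊆ S := by
    intro x hx
    rw [Function.mem_support, bumpTensor_apply] at hx
    have hx' : g (x 0) * h (x 1) ≠ 0 := by exact_mod_cast hx
    obtain ⟨hg, hh⟩ := mul_ne_zero_iff.1 hx'
    have hg' : x 0 ∈ Function.support g := hg
    have hh' : x 1 ∈ Function.support h := hh
    rw [ContDiffBump.support_eq] at hg' hh'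
    exact ⟨Metric.ball_subset_closedBall hg', Metric.ball_subset_closedBall hh'⟩
  intro x hx hloc
  have hxS : x ∈ S := (closure_minimal hsub hS) hx
  obtain ⟨i, j, hij, hxij⟩ := hloc
  have h01 : x 0 = x 1 := by
    fin_cases i <;> fin_cases j
    · exact absurd rfl hij
    · exact hxij
    · exact hxij.symm
    · exact absurd rfl hij
  obtain ⟨h0, h1⟩ := hxS
  rw [Metric.mem_closedBall, h01] at h0
  rw [Metric.mem_closedBall] at h1
  have : ‖c₀ - c₁‖ ≤ g.rOut + h.rOut := by
    calc ‖c₀ - c₁‖ = dist c₀ c₁ := (dist_eq_norm _ _).symm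
      _ ≤ dist c₀ (x 1) + dist (x 1) c₁ := dist_triangle _ _ _
      _ ≤ g.rOut + h.rOut := by rw [dist_comm] ; exact add_le_add h0 h1
  linarith

/-- **Pinning lemma.** A kernel continuous off `0` whose two-point functional vanishes on every
off-diagonal test function vanishes off `0`. -/
theorem kernel_eq_zero_off_origin (K : E4 → ℝ) (hK : ContinuousOn K {x : E4 | x ≠ 0})
    (h0 : ∀ F : 𝓢((Fin 2 → E4), ℂ), IsOffDiagonal F →
      Integrable (fun x : Fin 2 → E4 => (K (x 0 - x 1) : ℂ) * F x) ∧
        ∫ x : Fin 2 → E4, (K (x 0 - x 1) : ℂ) * F x = 0) :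
    ∀ x : E4, x ≠ 0 → K x = 0 := by
  intro x₀ hx₀
  by_contra hne
  set κ := K x₀ with hκdef
  have hκ : 0 < |κ| := abs_pos.2 hne
  -- continuity of K at x₀
  have hopen : IsOpen {x : E4 | x ≠ 0} := isOpen_compl_singleton
  have hcont : ContinuousAt K x₀ := (hK x₀ hx₀).continuousAt (hopen.mem_nhds hx₀)
  obtain ⟨ρ, hρ, hρK⟩ := Metric.continuousAt_iff.1 hcont (|κ| / 2) (half_pos hκ)
  -- radius of the bumps
  have hn0 : 0 < ‖x₀‖ := norm_pos_iff.2 hx₀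
  set r : ℝ := min (ρ / 4) (‖x₀‖ / 4) with hrdef
  have hr : 0 < r := lt_min (by linarith) (by linarith)
  have hrρ : r ≤ ρ / 4 := min_le_left _ _
  have hrx : r ≤ ‖x₀‖ / 4 := min_le_right _ _
  let g : ContDiffBump x₀ := ⟨r / 2, r, by linarith, by linarith⟩
  let h : ContDiffBump (0 : E4) := ⟨r / 2, r, by linarith, by linarith⟩
  have hsep : g.rOut + h.rOut < ‖x₀ - 0‖ := by
    show r + r < ‖x₀ - 0‖; rw [sub_zero]; linarith
  obtain ⟨hint, hI⟩ := h0 (bumpTensor g h) (isOffDiagonal_bumpTensor g h hsep)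
  -- the real integrand
  set fR : (Fin 2 → E4) → ℝ := fun x => K (x 0 - x 1) * (g (x 0) * h (x 1)) with hfR
  have hfun : (fun x : Fin 2 → E4 => (K (x 0 - x 1) : ℂ) * bumpTensor g h x) =
      fun x => ((fR x : ℝ) : ℂ) := by
    funext x; rw [bumpTensor_apply]; push_cast; simp [fR]
  rw [hfun] at hint hI
  have hintR : Integrable fR := by
    have := hint.re
    simpa using this
  have hIR : ∫ x, fR x = 0 := by
    have h1 : ((∫ x, fR x : ℝ) : ℂ) = 0 := by rw [← integral_complex_ofReal]; exact hI
    exact_mod_cast h1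
  -- lower bound ℓ ≤ κ * fR
  set ℓ : (Fin 2 → E4) → ℝ := fun x => κ ^ 2 / 2 * (g (x 0) * h (x 1)) with hℓ
  have hℓ_le : ∀ x, ℓ x ≤ κ * fR x := by
    intro x
    by_cases hgh : g (x 0) * h (x 1) = 0
    · simp [ℓ, fR, hgh]
    obtain ⟨hg1, hh1⟩ := mul_ne_zero_iff.1 hgh
    have hg2 : x 0 ∈ Metric.ball x₀ r := by
      have : x 0 ∈ Function.support g := hg1
      rwa [ContDiffBump.support_eq] at this
    have hh2 : x 1 ∈ Metric.ball (0 : E4) r := by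
      have : x 1 ∈ Function.support h := hh1
      rwa [ContDiffBump.support_eq] at this
    rw [Metric.mem_ball, dist_eq_norm] at hg2 hh2
    rw [sub_zero] at hh2
    have hd : dist (x 0 - x 1) x₀ < ρ := by
      rw [dist_eq_norm]
      calc ‖x 0 - x 1 - x₀‖ = ‖(x 0 - x₀) - x 1‖ := by congr 1; abel
        _ ≤ ‖x 0 - x₀‖ + ‖x 1‖ := norm_sub_le _ _
        _ < r + r := add_lt_add hg2 hh2
        _ ≤ ρ := by linarith
    have hKx := hρK hd
    rw [Real.dist_eq] at hKx
    have hprod : 0 ≤ g (x 0) * h (x 1) := mul_nonneg g.nonneg h.nonneg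
    have hkey : κ ^ 2 / 2 ≤ κ * K (x 0 - x 1) := by
      have h1 : |κ| * |K (x 0 - x 1) - κ| ≤ |κ| * (|κ| / 2) :=
        mul_le_mul_of_nonneg_left hKx.le (abs_nonneg _)
      have h2 : -(|κ| * |K (x 0 - x 1) - κ|) ≤ κ * (K (x 0 - x 1) - κ) := by
        rw [← abs_mul]; exact neg_abs_le _
      have h3 : |κ| * |κ| = κ ^ 2 := by rw [← sq, sq_abs]
      nlinarith
    calc ℓ x = κ ^ 2 / 2 * (g (x 0) * h (x 1)) := rfl
      _ ≤ κ * K (x 0 - x 1) * (g (x 0) * h (x 1)) := mul_le_mul_of_nonneg_right hkey hprod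
      _ = κ * fR x := by simp [fR]; ring
  -- ℓ is continuous, compactly supported, nonneg, positive at (x₀, 0)
  have hℓ_cont : Continuous ℓ :=
    continuous_const.mul ((g.continuous.comp (continuous_apply 0)).mul
      (h.continuous.comp (continuous_apply 1)))
  have hℓ_supp : HasCompactSupport ℓ := by
    let B : Fin 2 → Set E4 := ![Metric.closedBall x₀ r, Metric.closedBall (0 : E4) r]
    refine HasCompactSupport.intro (K := Set.pi Set.univ B)
      (isCompact_univ_pi fun i => ?_) ?_
    · fin_cases i <;> exact isCompact_closedBall _ _
    · intro x hx
      rw [Set.mem_univ_pi, Fin.forall_fin_two] at hx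
      simp only [ℓ]
      have : g (x 0) * h (x 1) = 0 := by
        by_contra hgh
        obtain ⟨hg1, hh1⟩ := mul_ne_zero_iff.1 hgh
        have hg2 : x 0 ∈ Function.support g := hg1
        have hh2 : x 1 ∈ Function.support h := hh1
        rw [ContDiffBump.support_eq] at hg2 hh2
        exact hx ⟨Metric.ball_subset_closedBall hg2, Metric.ball_subset_closedBall hh2⟩
      rw [this, mul_zero]
  have hℓ_nonneg : 0 ≤ ℓ := fun x => by
    simp only [ℓ, Pi.zero_apply]; exact mul_nonneg (by positivity) (mul_nonneg g.nonneg h.nonneg)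
  let xs : Fin 2 → E4 := ![x₀, 0]
  have hℓ_xs : ℓ xs ≠ 0 := by
    have hg1 : g (xs 0) = 1 := g.one_of_mem_closedBall (by simpa [xs, g] using (half_pos hr).le)
    have hh1 : h (xs 1) = 1 := h.one_of_mem_closedBall (by simpa [xs, h] using (half_pos hr).le)
    simp only [ℓ, hg1, hh1, mul_one]
    positivity
  have hpos : 0 < ∫ x, ℓ x :=
    hℓ_cont.integral_pos_of_hasCompactSupport_nonneg_nonzero hℓ_supp hℓ_nonneg hℓ_xs
  have hle : ∫ x, ℓ x ≤ ∫ x, κ * fR x :=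
    integral_mono_of_nonneg (Eventually.of_forall hℓ_nonneg) (hintR.const_mul κ)
      (Eventually.of_forall hℓ_le)
  have hzero : ∫ x, κ * fR x = 0 := by rw [integral_const_mul, hIR, mul_zero]
  linarith [hle, hzero, hpos]

/-- **Kernel uniqueness.** Two kernels continuous off `0` representing the same two-point
functional on `⁰𝒮` agree off `0`. -/
theorem kernel_unique {T : TwoPointCLM} {K K' : E4 → ℝ}
    (hK : ContinuousOn K {x : E4 | x ≠ 0}) (hK' : ContinuousOn K' {x : E4 | x ≠ 0})
    (hrep : RepresentsCLM T K) (hrep' : RepresentsCLM T K') :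
    ∀ x : E4, x ≠ 0 → K x = K' x := by
  have h := kernel_eq_zero_off_origin (fun x => K x - K' x) (hK.sub hK') (fun F hF => by
    obtain ⟨h1, h2⟩ := hrep F hF
    obtain ⟨h1', h2'⟩ := hrep' F hF
    have hfun : (fun x : Fin 2 → E4 => (((fun x => K x - K' x) (x 0 - x 1) : ℝ) : ℂ) * F x) =
        fun x => (K (x 0 - x 1) : ℂ) * F x - (K' (x 0 - x 1) : ℂ) * F x := by
      funext x; push_cast; ring
    refine ⟨by rw [hfun]; exact h1.sub h1', ?_⟩
    rw [hfun, integral_sub h1 h1', ← h2, ← h2', sub_self])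
  intro x hx
  exact sub_eq_zero.1 (h x hx)

/-- **The `∃ K` of the crux is a property of THE kernel.** If `S₁ 2` is represented on `⁰𝒮` by
some kernel `K₀` continuous off `0` (e.g. the explicit lattice-limit kernel), then the conclusion of
the crux holds iff `K₀` itself obeys the bound `|K₀ x| ≤ C (1 + ‖x‖^(η-10))` for some `C`, `η > 0`. -/
theorem representsCLM_kernelData_iff {T : TwoPointCLM} {K₀ : E4 → ℝ}
    (hK₀ : ContinuousOn K₀ {x : E4 | x ≠ 0}) (hrep : RepresentsCLM T K₀) :
    (∃ (K : E4 → ℝ) (C η : ℝ), KernelData K C η ∧ RepresentsCLM T K) ↔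
      ∃ C η : ℝ, KernelData K₀ C η := by
  constructor
  · rintro ⟨K, C, η, ⟨hη, hK, hb⟩, hrepK⟩
    refine ⟨C, η, hη, hK₀, fun x hx => ?_⟩
    rw [← kernel_unique hK hK₀ hrepK hrep x hx]
    exact hb x hx
  · rintro ⟨C, η, hKD⟩
    exact ⟨K₀, C, η, hKD, hrep⟩

theorem kernelConclusion_iff_of_represents {S₁ : SchwingerFamily E4} {K₀ : E4 → ℝ}
    (hK₀ : ContinuousOn K₀ {x : E4 | x ≠ 0}) (hrep : Represents S₁ K₀) :
    KernelConclusion S₁ ↔ ∃ C η : ℝ, KernelData K₀ C η := by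
  rw [kernelConclusion_iff]
  constructor
  · rintro ⟨K, C, η, ⟨hη, hK, hb⟩, hrepK⟩
    refine ⟨C, η, hη, hK₀, fun x hx => ?_⟩
    rw [← kernel_unique hK hK₀ hrepK hrep x hx]
    exact hb x hx
  · rintro ⟨C, η, hKD⟩
    exact ⟨K₀, C, η, hKD, hrep⟩

end Pinning



/-! ## §F Free-field UV calibration in `d = 4` (support for §D and for provers' Gaussian checks):
`e^{-m‖x‖}/(4π²‖x‖²) ≤ G_m(x) ≤ 1/(4π²‖x‖²)` for the tree's free propagator kernel
`G_m(x) = ∫₀^∞ e^{-m²t} p_t(x) dt`, hence `s² G_m(s w) → (4π²‖w‖²)⁻¹` uniformly on annuli. -/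

namespace FreeKernel

open Real Literature.Analysis.UnboundedOperators

theorem finrank_E4 : Module.finrank ℝ E4 = 4 := by simp

/-- The subordination integrand in `d = 4`: `φ_r(t) = (4πt)⁻² e^{-r²/(4t)}`. -/
def φ (r t : ℝ) : ℝ := ((4 * π * t) ^ 2)⁻¹ * Real.exp (-r ^ 2 / (4 * t))

/-- Its primitive `Φ_r(t) = e^{-r²/(4t)}/(4π²r²)` for `t > 0`, extended by `0`. -/
def Φ (r t : ℝ) : ℝ := if t ≤ 0 then 0 else Real.exp (-r ^ 2 / (4 * t)) / (4 * π ^ 2 * r ^ 2)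

theorem Φ_of_pos (r : ℝ) {t : ℝ} (ht : 0 < t) :
    Φ r t = Real.exp (-r ^ 2 / (4 * t)) / (4 * π ^ 2 * r ^ 2) := by
  simp [Φ, not_le.2 ht]

theorem Φ_zero (r : ℝ) : Φ r 0 = 0 := by simp [Φ]

/-- The heat kernel on `ℝ⁴`: `p_t(x) = (4πt)⁻² e^{-‖x‖²/(4t)}`. -/
theorem heatKernel_E4 {t : ℝ} (ht : 0 < t) (x : E4) : heatKernel t x = φ ‖x‖ t := by
  unfold heatKernel φ
  rw [finrank_E4]
  congr 1
  have h4 : (0 : ℝ) ≤ 4 * π * t := by positivity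
  rw [show (-((4 : ℕ) : ℝ) / 2) = -(2 : ℝ) by norm_num, Real.rpow_neg h4, Real.rpow_two]

theorem φ_nonneg (r t : ℝ) : 0 ≤ φ r t := by unfold φ; positivity

theorem hasDerivAt_Φ {r t : ℝ} (hr : r ≠ 0) (ht : 0 < t) : HasDerivAt (Φ r) (φ r t) t := by
  have hΦ : (Φ r) =ᶠ[𝓝 t] fun s => Real.exp (-r ^ 2 / (4 * s)) / (4 * π ^ 2 * r ^ 2) := by
    filter_upwards [Ioi_mem_nhds ht] with s hs
    exact Φ_of_pos r hs
  refine HasDerivAt.congr_of_eventuallyEq ?_ hΦ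
  -- derivative of the explicit formula
  have h1 : HasDerivAt (fun s : ℝ => -r ^ 2 / (4 * s)) (r ^ 2 / (4 * t ^ 2)) t := by
    have h := ((hasDerivAt_inv ht.ne').const_mul (-r ^ 2 / 4))
    have heq : (fun s : ℝ => -r ^ 2 / (4 * s)) = fun y => -r ^ 2 / 4 * y⁻¹ := by
      funext s; ring
    rw [heq]
    refine h.congr_deriv ?_
    field_simp
  have h2 := (h1.exp).div_const (4 * π ^ 2 * r ^ 2)
  refine h2.congr_deriv ?_
  unfold φ
  field_simp

theorem tendsto_exp_neg_div_nhdsGT (r : ℝ) (hr : r ≠ 0) :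
    Tendsto (fun t : ℝ => Real.exp (-r ^ 2 / (4 * t))) (𝓝[>] 0) (𝓝 0) := by
  have hc : 0 < r ^ 2 / 4 := by positivity
  have h1 : Tendsto (fun t : ℝ => r ^ 2 / 4 * t⁻¹) (𝓝[>] 0) atTop :=
    tendsto_inv_nhdsGT_zero.const_mul_atTop hc
  have h2 : Tendsto (fun t : ℝ => -(r ^ 2 / 4 * t⁻¹)) (𝓝[>] 0) atBot :=
    tendsto_neg_atTop_atBot.comp h1
  have h3 := Real.tendsto_exp_atBot.comp h2
  refine h3.congr' ?_
  filter_upwards [self_mem_nhdsWithin] with t ht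
  simp only [Function.comp_apply]
  congr 1
  rw [mem_Ioi] at ht
  field_simp

theorem continuousWithinAt_Φ_zero (r : ℝ) (hr : r ≠ 0) : ContinuousWithinAt (Φ r) (Ici 0) 0 := by
  rw [← Ioi_insert, continuousWithinAt_insert_self]
  show Tendsto (Φ r) (𝓝[>] 0) (𝓝 (Φ r 0))
  rw [Φ_zero]
  have h := (tendsto_exp_neg_div_nhdsGT r hr).div_const (4 * π ^ 2 * r ^ 2)
  rw [zero_div] at h
  refine h.congr' ?_
  filter_upwards [self_mem_nhdsWithin] with t ht
  exact (Φ_of_pos r ht).symm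

theorem continuousWithinAt_Φ {r a : ℝ} (hr : r ≠ 0) (ha : 0 ≤ a) :
    ContinuousWithinAt (Φ r) (Ici a) a := by
  rcases ha.eq_or_lt with rfl | ha'
  · exact continuousWithinAt_Φ_zero r hr
  · exact (hasDerivAt_Φ hr ha').continuousAt.continuousWithinAt

theorem tendsto_Φ_atTop (r : ℝ) (hr : r ≠ 0) :
    Tendsto (Φ r) atTop (𝓝 (1 / (4 * π ^ 2 * r ^ 2))) := by
  have h1 : Tendsto (fun t : ℝ => -r ^ 2 / 4 * t⁻¹) atTop (𝓝 (-r ^ 2 / 4 * 0)) :=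
    tendsto_inv_atTop_zero.const_mul _
  rw [mul_zero] at h1
  have h2 : Tendsto (fun t : ℝ => Real.exp (-r ^ 2 / 4 * t⁻¹)) atTop (𝓝 1) := by
    simpa [Function.comp_def] using (Real.continuous_exp.tendsto 0).comp h1
  have h3 := h2.div_const (4 * π ^ 2 * r ^ 2)
  refine h3.congr' ?_
  filter_upwards [eventually_gt_atTop 0] with t ht
  rw [Φ_of_pos r ht]
  congr 2
  field_simp

/-- `∫_a^∞ φ_r = 1/(4π²r²) − Φ_r(a)` for `a ≥ 0`, and `φ_r` is integrable there. -/
theorem integral_φ_Ioi {r a : ℝ} (hr : r ≠ 0) (ha : 0 ≤ a) :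
    ∫ t in Ioi a, φ r t = 1 / (4 * π ^ 2 * r ^ 2) - Φ r a :=
  integral_Ioi_of_hasDerivAt_of_nonneg (continuousWithinAt_Φ hr ha)
    (fun _ ht => hasDerivAt_Φ hr (ha.trans_lt ht)) (fun t _ => φ_nonneg r t) (tendsto_Φ_atTop r hr)

theorem integrableOn_φ_Ioi {r a : ℝ} (hr : r ≠ 0) (ha : 0 ≤ a) :
    IntegrableOn (φ r) (Ioi a) :=
  integrableOn_Ioi_deriv_of_nonneg (continuousWithinAt_Φ hr ha)
    (fun _ ht => hasDerivAt_Φ hr (ha.trans_lt ht)) (fun t _ => φ_nonneg r t) (tendsto_Φ_atTop r hr)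

/-- `∫₀^T φ_r = Φ_r(T)`. -/
theorem integral_φ_Ioc {r T : ℝ} (hr : r ≠ 0) (hT : 0 < T) :
    ∫ t in Ioc 0 T, φ r t = Φ r T := by
  have hu : Ioc 0 T ∪ Ioi T = Ioi 0 := Ioc_union_Ioi_eq_Ioi hT.le
  have hdisj : Disjoint (Ioc 0 T) (Ioi T) := fun s h1 h2 x hx => by
    have a := h1 hx; have b := h2 hx
    exact absurd (mem_Ioc.1 a).2 (not_le.2 (mem_Ioi.1 b))
  have hint := integrableOn_φ_Ioi hr le_rfl (a := 0)
  have h := setIntegral_union hdisj measurableSet_Ioi (hint.mono_set (by rw [← hu]; exact subset_union_left))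
    (hint.mono_set (by rw [← hu]; exact subset_union_right))
  rw [hu, integral_φ_Ioi hr le_rfl, integral_φ_Ioi hr hT.le, Φ_zero] at h
  linarith

/-- The free propagator kernel of mass `m` on `ℝ⁴` (tree convention, written out). -/
def G (m : ℝ) (x : E4) : ℝ := ∫ t in Ioi (0 : ℝ), Real.exp (-m ^ 2 * t) * heatKernel t x

theorem G_eq (m : ℝ) (x : E4) : G m x = ∫ t in Ioi (0 : ℝ), Real.exp (-m ^ 2 * t) * φ ‖x‖ t :=
  setIntegral_congr_fun measurableSet_Ioi fun t ht => by rw [heatKernel_E4 (mem_Ioi.1 ht)]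

/-- **Upper bound** `G_m(x) ≤ 1/(4π²‖x‖²)` (`x ≠ 0`). -/
theorem G_le {m : ℝ} {x : E4} (hx : x ≠ 0) : G m x ≤ 1 / (4 * π ^ 2 * ‖x‖ ^ 2) := by
  have hr : ‖x‖ ≠ 0 := norm_ne_zero_iff.2 hx
  have h : ∫ t in Ioi 0, φ ‖x‖ t = 1 / (4 * π ^ 2 * ‖x‖ ^ 2) := by
    rw [integral_φ_Ioi hr le_rfl, Φ_zero, sub_zero]
  rw [G_eq, ← h]
  refine setIntegral_mono_on ?_ (integrableOn_φ_Ioi hr le_rfl) measurableSet_Ioi fun t ht => ?_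
  · refine (integrableOn_φ_Ioi hr le_rfl).mono' ?_ ?_
    · exact ((Real.continuous_exp.comp (continuous_const.mul continuous_id)).aestronglyMeasurable).mul
        (integrableOn_φ_Ioi hr le_rfl).aestronglyMeasurable
    · refine (ae_restrict_iff' measurableSet_Ioi).2 (ae_of_all _ fun t ht => ?_)
      rw [Real.norm_eq_abs, abs_mul, abs_of_nonneg (Real.exp_pos _).le, abs_of_nonneg (φ_nonneg _ _)]
      refine mul_le_of_le_one_left (φ_nonneg _ _) ?_
      rw [Real.exp_le_one_iff]
      nlinarith [mem_Ioi.1 ht, sq_nonneg m]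
  · refine mul_le_of_le_one_left (φ_nonneg _ _) ?_
    rw [Real.exp_le_one_iff]
    nlinarith [mem_Ioi.1 ht, sq_nonneg m]

/-- **Lower bound** `e^{-m‖x‖}/(4π²‖x‖²) ≤ G_m(x)` (`0 < m`, `x ≠ 0`). -/
theorem G_ge {m : ℝ} (hm : 0 < m) {x : E4} (hx : x ≠ 0) :
    Real.exp (-(m * ‖x‖)) / (4 * π ^ 2 * ‖x‖ ^ 2) ≤ G m x := by
  set r := ‖x‖ with hrdef
  have hr0 : 0 < r := norm_pos_iff.2 hx
  have hr : r ≠ 0 := hr0.ne'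
  set T := r / (2 * m) with hT
  have hT0 : 0 < T := by positivity
  -- restrict to (0, T]
  have hint : IntegrableOn (fun t => Real.exp (-m ^ 2 * t) * φ r t) (Ioi 0) := by
    refine (integrableOn_φ_Ioi hr le_rfl).mono' ?_ ?_
    · exact ((Real.continuous_exp.comp (continuous_const.mul continuous_id)).aestronglyMeasurable).mul
        (integrableOn_φ_Ioi hr le_rfl).aestronglyMeasurable
    · refine (ae_restrict_iff' measurableSet_Ioi).2 (ae_of_all _ fun t ht => ?_)
      rw [Real.norm_eq_abs, abs_mul, abs_of_nonneg (Real.exp_pos _).le, abs_of_nonneg (φ_nonneg _ _)]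
      refine mul_le_of_le_one_left (φ_nonneg _ _) ?_
      rw [Real.exp_le_one_iff]
      nlinarith [mem_Ioi.1 ht, sq_nonneg m]
  have step1 : ∫ t in Ioc 0 T, Real.exp (-m ^ 2 * t) * φ r t ≤ G m x := by
    rw [G_eq]
    exact setIntegral_mono_set hint
      (Eventually.of_forall fun t => mul_nonneg (Real.exp_pos _).le (φ_nonneg _ _))
      Ioc_subset_Ioi_self.eventuallyLE
  have step2 : Real.exp (-m ^ 2 * T) * Φ r T ≤ ∫ t in Ioc 0 T, Real.exp (-m ^ 2 * t) * φ r t := by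
    rw [← integral_φ_Ioc hr hT0, ← integral_const_mul]  -- ∫ e^{-m²T} φ
    refine setIntegral_mono_on ?_ (hint.mono_set Ioc_subset_Ioi_self) measurableSet_Ioc fun t ht => ?_
    · exact ((integrableOn_φ_Ioi hr le_rfl).mono_set Ioc_subset_Ioi_self).const_mul _
    · refine mul_le_mul_of_nonneg_right ?_ (φ_nonneg _ _)
      exact Real.exp_le_exp.2 (by nlinarith [(mem_Ioc.1 ht).2, sq_nonneg m])
  have step3 : Real.exp (-m ^ 2 * T) * Φ r T = Real.exp (-(m * r)) / (4 * π ^ 2 * r ^ 2) := by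
    rw [Φ_of_pos r hT0, mul_div_assoc', ← Real.exp_add]
    congr 2
    rw [hT]; field_simp; ring
  linarith [step1, step2, step3.symm.le, step3.le]


/-- **Uniform free-field asymptotics on annuli**: `|s² G_m(s w) − 1/(4π²‖w‖²)| ≤ m s/(4π²‖w‖)`
(`0 < m`, `w ≠ 0`, `0 < s`): `s² G_m(s·)` converges to the massless kernel `(4π²‖w‖²)⁻¹`
uniformly on `{‖w‖ ≥ δ}` at rate `O(s)`. -/
theorem abs_sq_mul_G_smul_sub_le {m : ℝ} (hm : 0 < m) {w : E4} (hw : w ≠ 0) {s : ℝ} (hs : 0 < s) :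
    |s ^ 2 * G m (s • w) - 1 / (4 * π ^ 2 * ‖w‖ ^ 2)| ≤ m * s / (4 * π ^ 2 * ‖w‖) := by
  have hsw : s • w ≠ 0 := smul_ne_zero hs.ne' hw
  have h1 := G_le (m := m) hsw
  have h2 := G_ge hm hsw
  rw [norm_smul, Real.norm_of_nonneg hs.le] at h1 h2
  have hr : 0 < ‖w‖ := norm_pos_iff.2 hw
  have key_up : s ^ 2 * G m (s • w) ≤ 1 / (4 * π ^ 2 * ‖w‖ ^ 2) := by
    calc s ^ 2 * G m (s • w) ≤ s ^ 2 * (1 / (4 * π ^ 2 * (s * ‖w‖) ^ 2)) := by gcongr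
      _ = 1 / (4 * π ^ 2 * ‖w‖ ^ 2) := by field_simp
  have key_lo : Real.exp (-(m * (s * ‖w‖))) / (4 * π ^ 2 * ‖w‖ ^ 2) ≤ s ^ 2 * G m (s • w) := by
    calc Real.exp (-(m * (s * ‖w‖))) / (4 * π ^ 2 * ‖w‖ ^ 2)
        = s ^ 2 * (Real.exp (-(m * (s * ‖w‖))) / (4 * π ^ 2 * (s * ‖w‖) ^ 2)) := by
          field_simp
      _ ≤ s ^ 2 * G m (s • w) := by gcongr
  have hexp : 1 - Real.exp (-(m * (s * ‖w‖))) ≤ m * (s * ‖w‖) := by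
    have := Real.add_one_le_exp (-(m * (s * ‖w‖)))
    linarith
  rw [abs_sub_le_iff]
  constructor
  · have : 0 ≤ m * s / (4 * π ^ 2 * ‖w‖) := by positivity
    linarith
  · calc 1 / (4 * π ^ 2 * ‖w‖ ^ 2) - s ^ 2 * G m (s • w)
        ≤ 1 / (4 * π ^ 2 * ‖w‖ ^ 2) - Real.exp (-(m * (s * ‖w‖))) / (4 * π ^ 2 * ‖w‖ ^ 2) := by
          linarith
      _ = (1 - Real.exp (-(m * (s * ‖w‖)))) / (4 * π ^ 2 * ‖w‖ ^ 2) := by ring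
      _ ≤ m * (s * ‖w‖) / (4 * π ^ 2 * ‖w‖ ^ 2) := by gcongr
      _ = m * s / (4 * π ^ 2 * ‖w‖) := by field_simp


end FreeKernel

/-! ## §G Order-insufficiency CORE: functionals `T = T₀ ∘ L` (dressed free two-point functions) -/

section Core

open Real
open scoped LineDeriv

/-- `G_m ≥ 0`. -/
theorem FreeKernel.G_nonneg (m : ℝ) (x : E4) : 0 ≤ FreeKernel.G m x :=
  setIntegral_nonneg measurableSet_Ioi fun _ ht =>
    mul_nonneg (Real.exp_pos _).le (Literature.Analysis.UnboundedOperators.heatKernel_pos (mem_Ioi.1 ht) x).le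

/-- `G_m` is strongly measurable. -/
theorem FreeKernel.stronglyMeasurable_G (m : ℝ) : StronglyMeasurable (FreeKernel.G m) := by
  have hmeas : Measurable fun p : E4 × ℝ =>
      Real.exp (-m ^ 2 * p.2) * Literature.Analysis.UnboundedOperators.heatKernel p.2 p.1 := by
    unfold Literature.Analysis.UnboundedOperators.heatKernel; fun_prop
  exact hmeas.stronglyMeasurable.integral_prod_right' (ν := volume.restrict (Ioi (0 : ℝ)))

/-- The massless kernel `(4π²‖w‖²)⁻¹` as a function of the relative coordinate. -/
def masslessWeight (u : Fin 2 → E4) : ℝ := 1 / (4 * π ^ 2 * ‖u 0 - u 1‖ ^ 2)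

theorem measurable_masslessWeight : Measurable masslessWeight := by
  unfold masslessWeight; fun_prop

/-- **Rescaled free two-point integrals converge to the massless moment at rate `O(s)`.** -/
theorem norm_sq_integral_G_dil_sub_le {m : ℝ} (hm : 0 < m) (Ψ : 𝓢((Fin 2 → E4), ℂ)) {δ : ℝ}
    (hδ : 0 < δ) (hsep : ∀ u, Ψ u ≠ 0 → δ ≤ ‖u 0 - u 1‖) {s : ℝ} (hs : 0 < s) :
    ‖((s ^ 2 : ℝ) : ℂ) * (∫ u, (FreeKernel.G m (s • (u 0 - u 1)) : ℂ) * Ψ u) -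
        ∫ u, (masslessWeight u : ℂ) * Ψ u‖ ≤ m * s / (4 * π ^ 2 * δ) * ∫ u, ‖Ψ u‖ := by
  -- measurability
  have hmeasG : AEStronglyMeasurable
      (fun u : Fin 2 → E4 => (FreeKernel.G m (s • (u 0 - u 1)) : ℂ)) volume := by
    have h1 : Measurable fun u : Fin 2 → E4 => s • (u 0 - u 1) := by fun_prop
    exact (Complex.continuous_ofReal.measurable.comp
      ((FreeKernel.stronglyMeasurable_G m).measurable.comp h1)).aestronglyMeasurable
  have hmeasW : AEStronglyMeasurable (fun u : Fin 2 → E4 => (masslessWeight u : ℂ)) volume :=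
    (Complex.continuous_ofReal.measurable.comp measurable_masslessWeight).aestronglyMeasurable
  -- pointwise bounds on the support
  have hw0 : ∀ u, Ψ u ≠ 0 → u 0 - u 1 ≠ 0 := fun u hu h0 => by
    have := hsep u hu; rw [h0, norm_zero] at this; linarith
  have hGb : ∀ u, ‖(FreeKernel.G m (s • (u 0 - u 1)) : ℂ) * Ψ u‖ ≤
      1 / (4 * π ^ 2 * (s * δ) ^ 2) * ‖Ψ u‖ := by
    intro u
    by_cases hu : Ψ u = 0
    · simp [hu]
    have hw := hw0 u hu
    rw [norm_mul, Complex.norm_real, Real.norm_of_nonneg (FreeKernel.G_nonneg _ _)]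
    refine mul_le_mul_of_nonneg_right ?_ (norm_nonneg _)
    have h1 := FreeKernel.G_le (m := m) (smul_ne_zero hs.ne' hw)
    rw [norm_smul, Real.norm_of_nonneg hs.le] at h1
    refine h1.trans ?_
    have : s * δ ≤ s * ‖u 0 - u 1‖ := mul_le_mul_of_nonneg_left (hsep u hu) hs.le
    have hsd : 0 < s * δ := by positivity
    gcongr
  have hWb : ∀ u, ‖(masslessWeight u : ℂ) * Ψ u‖ ≤ 1 / (4 * π ^ 2 * δ ^ 2) * ‖Ψ u‖ := by
    intro u
    by_cases hu : Ψ u = 0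
    · simp [hu]
    rw [norm_mul, Complex.norm_real, Real.norm_of_nonneg (by unfold masslessWeight; positivity)]
    refine mul_le_mul_of_nonneg_right ?_ (norm_nonneg _)
    unfold masslessWeight
    have := hsep u hu
    gcongr
  have hintG : Integrable (fun u : Fin 2 → E4 => (FreeKernel.G m (s • (u 0 - u 1)) : ℂ) * Ψ u) :=
    Integrable.mono' ((Ψ.integrable.norm).const_mul _) (hmeasG.mul Ψ.continuous.aestronglyMeasurable)
      (Eventually.of_forall hGb)
  have hintW : Integrable (fun u : Fin 2 → E4 => (masslessWeight u : ℂ) * Ψ u) :=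
    Integrable.mono' ((Ψ.integrable.norm).const_mul _) (hmeasW.mul Ψ.continuous.aestronglyMeasurable)
      (Eventually.of_forall hWb)
  -- the difference, pointwise
  have hpt : ∀ u, ‖((s ^ 2 : ℝ) : ℂ) * ((FreeKernel.G m (s • (u 0 - u 1)) : ℂ) * Ψ u) -
      (masslessWeight u : ℂ) * Ψ u‖ ≤ m * s / (4 * π ^ 2 * δ) * ‖Ψ u‖ := by
    intro u
    by_cases hu : Ψ u = 0
    · simp [hu]
    have hw := hw0 u hu
    have hfac : ((s ^ 2 : ℝ) : ℂ) * ((FreeKernel.G m (s • (u 0 - u 1)) : ℂ) * Ψ u) -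
        (masslessWeight u : ℂ) * Ψ u =
        ((s ^ 2 * FreeKernel.G m (s • (u 0 - u 1)) - masslessWeight u : ℝ) : ℂ) * Ψ u := by
      push_cast; ring
    rw [hfac, norm_mul, Complex.norm_real, Real.norm_eq_abs]
    refine mul_le_mul_of_nonneg_right ?_ (norm_nonneg _)
    have h := FreeKernel.abs_sq_mul_G_smul_sub_le hm hw hs
    unfold masslessWeight
    refine h.trans ?_
    have := hsep u hu
    have hmspos : 0 ≤ m * s := by positivity
    gcongr
  rw [← integral_const_mul, ← integral_sub (hintG.const_mul _) hintW]
  calc ‖∫ u, ((s ^ 2 : ℝ) : ℂ) * ((FreeKernel.G m (s • (u 0 - u 1)) : ℂ) * Ψ u) -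
          (masslessWeight u : ℂ) * Ψ u‖
      ≤ ∫ u, ‖((s ^ 2 : ℝ) : ℂ) * ((FreeKernel.G m (s • (u 0 - u 1)) : ℂ) * Ψ u) -
          (masslessWeight u : ℂ) * Ψ u‖ := norm_integral_le_integral_norm _
    _ ≤ ∫ u, m * s / (4 * π ^ 2 * δ) * ‖Ψ u‖ :=
        integral_mono_of_nonneg (Eventually.of_forall fun _ => norm_nonneg _)
          ((Ψ.integrable.norm).const_mul _) (Eventually.of_forall hpt)
    _ = m * s / (4 * π ^ 2 * δ) * ∫ u, ‖Ψ u‖ := integral_const_mul _ _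

/-- … hence `s_j² ∫ G_m(s_j w) Ψ → ∫ (4π²‖w‖²)⁻¹ Ψ` along any `s_j → 0⁺`. -/
theorem tendsto_sq_mul_integral_G_dil {m : ℝ} (hm : 0 < m) (Ψ : 𝓢((Fin 2 → E4), ℂ)) {δ : ℝ}
    (hδ : 0 < δ) (hsep : ∀ u, Ψ u ≠ 0 → δ ≤ ‖u 0 - u 1‖) {s : ℕ → ℝ} (hs : ∀ j, 0 < s j)
    (hs0 : Tendsto s atTop (𝓝 0)) :
    Tendsto (fun j => ((s j ^ 2 : ℝ) : ℂ) * ∫ u, (FreeKernel.G m (s j • (u 0 - u 1)) : ℂ) * Ψ u)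
      atTop (𝓝 (∫ u, (masslessWeight u : ℂ) * Ψ u)) := by
  rw [tendsto_iff_norm_sub_tendsto_zero]
  refine squeeze_zero (fun _ => norm_nonneg _)
    (fun j => norm_sq_integral_G_dil_sub_le hm Ψ hδ hsep (hs j)) ?_
  have h : Tendsto (fun j => m * s j / (4 * π ^ 2 * δ) * ∫ u, ‖Ψ u‖) atTop
      (𝓝 (m * 0 / (4 * π ^ 2 * δ) * ∫ u, ‖Ψ u‖)) :=
    ((tendsto_const_nhds.mul hs0).div_const _).mul tendsto_const_nhds
  simpa using h

/-- **Order-insufficiency core.** Let `T` be a two-point functional of the form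
`T F = ∫ G_m(u₀-u₁) (L F)(u) du`, `L` a continuous linear operator on two-point test functions
which is homogeneous of degree `-8` under dilations and does not enlarge supports (e.g.
`L = Σ_μ ∂_{(0,μ)}⁸`, §G'). If the MASSLESS MOMENT `J(F₀) = ∫ (4π²‖u₀-u₁‖²)⁻¹ (L F₀)(u) du` of
ONE off-diagonal `F₀` with `δ ≤ ‖u₀-u₁‖ ≤ R` on its support is nonzero, then `T` admits NO
kernel with the crux's bound (any `η > 0`): `s² T(F₀,s) → J(F₀) ≠ 0` against §B. What is left
for `¬ CurvatureKernelBoundWithoutLatticeSixteen` at the two-point level is bookkeeping (the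
package properties of `T`) plus ONE explicit eighth derivative (`J ≠ 0`). -/
theorem not_representable_of_masslessMoment_ne_zero {m : ℝ} (hm : 0 < m) (T : TwoPointCLM)
    (L : 𝓢((Fin 2 → E4), ℂ) →L[ℂ] 𝓢((Fin 2 → E4), ℂ))
    (hT : ∀ F, T F = ∫ u, (FreeKernel.G m (u 0 - u 1) : ℂ) * L F u)
    (hL_dil : ∀ (s : ℝ) (hs : 0 < s) (F : 𝓢((Fin 2 → E4), ℂ)),
      L (dil s hs.ne' F) = (s⁻¹ ^ 8 : ℝ) • dil s hs.ne' (L F))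
    (hL_supp : ∀ (F : 𝓢((Fin 2 → E4), ℂ)) (u : Fin 2 → E4), L F u ≠ 0 →
      u ∈ tsupport (F : (Fin 2 → E4) → ℂ))
    {F₀ : 𝓢((Fin 2 → E4), ℂ)} (hF₀ : IsOffDiagonal F₀) {δ R : ℝ} (hδ : 0 < δ)
    (hsep : ∀ u ∈ tsupport (F₀ : (Fin 2 → E4) → ℂ), δ ≤ ‖u 0 - u 1‖ ∧ ‖u 0 - u 1‖ ≤ R)
    (hJ : ∫ u, (masslessWeight u : ℂ) * L F₀ u ≠ 0) :
    ¬ ∃ (K : E4 → ℝ) (C η : ℝ), KernelData K C η ∧ RepresentsCLM T K := by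
  -- the dilation sequence `s_j = 1/(j+1)`
  set s : ℕ → ℝ := fun j => ((j : ℝ) + 1)⁻¹ with hsdef
  have hs : ∀ j, 0 < s j := fun j => by positivity
  have hs0 : Tendsto s atTop (𝓝 0) :=
    tendsto_inv_atTop_zero.comp (tendsto_natCast_atTop_atTop.atTop_add tendsto_const_nhds)
  have hsepF : ∀ u, F₀ u ≠ 0 → δ ≤ ‖u 0 - u 1‖ ∧ ‖u 0 - u 1‖ ≤ R :=
    fun u hu => hsep u (subset_tsupport _ hu)
  have hsepL : ∀ u, L F₀ u ≠ 0 → δ ≤ ‖u 0 - u 1‖ := fun u hu => (hsep u (hL_supp F₀ u hu)).1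
  refine not_representsCLM_of_dilation_blowup T hF₀ hδ hsepF hs hs0 fun hlim => ?_
  -- `T (F₀)_s = ∫ G_m(s w) (L F₀)`
  have hTdil : ∀ j, T (dil (s j) (hs j).ne' F₀) =
      ∫ u, (FreeKernel.G m (s j • (u 0 - u 1)) : ℂ) * L F₀ u := by
    intro j
    rw [hT, hL_dil (s j) (hs j)]
    have h1 : (fun u : Fin 2 → E4 => (FreeKernel.G m (u 0 - u 1) : ℂ) *
        (((s j)⁻¹ ^ 8 : ℝ) • dil (s j) (hs j).ne' (L F₀)) u) =
        fun u => (((s j)⁻¹ ^ 8 : ℝ) : ℂ) *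
          ((FreeKernel.G m (u 0 - u 1) : ℂ) * dil (s j) (hs j).ne' (L F₀) u) := by
      funext u
      rw [smul_apply, Complex.real_smul]
      ring
    rw [h1, integral_const_mul, integral_kernel_dil (FreeKernel.G m) (L F₀) (hs j),
      Complex.real_smul, ← mul_assoc]
    have hc : (((s j)⁻¹ ^ 8 : ℝ) : ℂ) * ((s j ^ 8 : ℝ) : ℂ) = 1 := by
      rw [← Complex.ofReal_mul, ← mul_pow, inv_mul_cancel₀ (hs j).ne', one_pow, Complex.ofReal_one]
    rw [hc, one_mul]
  -- the limit of `s² T(F₀,s)` is the massless moment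
  have h1 := tendsto_sq_mul_integral_G_dil hm (L F₀) hδ hsepL hs hs0
  have h2 : Tendsto (fun j => s j ^ 2 * ‖T (dil (s j) (hs j).ne' F₀)‖) atTop
      (𝓝 ‖∫ u, (masslessWeight u : ℂ) * L F₀ u‖) := by
    refine h1.norm.congr' (Eventually.of_forall fun j => ?_)
    show ‖((s j ^ 2 : ℝ) : ℂ) * ∫ u, (FreeKernel.G m (s j • (u 0 - u 1)) : ℂ) * L F₀ u‖ =
      s j ^ 2 * ‖T (dil (s j) (hs j).ne' F₀)‖
    rw [norm_mul, Complex.norm_real, Real.norm_of_nonneg (by positivity), hTdil j]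
  exact hJ (norm_eq_zero.1 (tendsto_nhds_unique h2 hlim))

end Core

/-! ## §G' The canonical dressing `L₈ = Σ_μ ∂_{(0,μ)}⁸` (degree `-8`, support-preserving) -/

section Dressing

open scoped LineDeriv

/-- The direction `e_μ` in slot `0` of a two-point configuration. -/
def V0 (μ : Fin 4) : Fin 2 → E4 := Pi.single 0 (EuclideanSpace.single μ 1)

/-- `∂_{(0,μ)}⁸` as a continuous linear operator on two-point test functions. -/
def D8 (μ : Fin 4) : 𝓢((Fin 2 → E4), ℂ) →L[ℂ] 𝓢((Fin 2 → E4), ℂ) :=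
  LineDeriv.iteratedLineDerivOpCLM ℂ (𝓢((Fin 2 → E4), ℂ)) (fun _ : Fin 8 => V0 μ)

/-- The dressing `L₈ = Σ_μ ∂_{(0,μ)}⁸` (symbol `Σ_μ k_μ⁸` on slot `0`; against `G_m(u₀-u₁)` it acts
like the symmetric `Σ_μ ∂_{(0,μ)}⁴∂_{(1,μ)}⁴`). -/
def L8 : 𝓢((Fin 2 → E4), ℂ) →L[ℂ] 𝓢((Fin 2 → E4), ℂ) := ∑ μ : Fin 4, D8 μ

theorem D8_apply (μ : Fin 4) (F : 𝓢((Fin 2 → E4), ℂ)) :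
    D8 μ F = ∂^{fun _ : Fin 8 => V0 μ} F := rfl

theorem L8_apply (F : 𝓢((Fin 2 → E4), ℂ)) : L8 F = ∑ μ : Fin 4, D8 μ F := by
  simp [L8]

/-- Chain rule under dilation for one line derivative. -/
theorem lineDerivOp_dil (v : Fin 2 → E4) {s : ℝ} (hs : s ≠ 0) (F : 𝓢((Fin 2 → E4), ℂ)) :
    ∂_{v} (dil s hs F) = s⁻¹ • dil s hs (∂_{v} F) := by
  have hg : (ContinuousLinearEquiv.smulLeft (Units.mk0 s hs)⁻¹ : (Fin 2 → E4) ≃L[ℝ] (Fin 2 → E4))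
      v = s⁻¹ • v := by
    show ((Units.mk0 s hs)⁻¹ : ℝˣ) • v = s⁻¹ • v
    rw [Units.smul_def, Units.val_inv_eq_inv_val, Units.val_mk0]
  change ∂_{v} (SchwartzMap.compCLMOfContinuousLinearEquiv ℂ
    (ContinuousLinearEquiv.smulLeft (Units.mk0 s hs)⁻¹ : (Fin 2 → E4) ≃L[ℝ] (Fin 2 → E4)) F) = _
  rw [SchwartzMap.lineDerivOp_compCLMOfContinuousLinearEquiv, hg,
    LineDerivLeftSMul.lineDerivOp_left_smul, ContinuousLinearMap.map_smul_of_tower]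
  rfl

/-- … and for the iterated derivative along a fixed direction. -/
theorem iteratedLineDerivOp_dil (v : Fin 2 → E4) {s : ℝ} (hs : s ≠ 0) (n : ℕ)
    (F : 𝓢((Fin 2 → E4), ℂ)) :
    ∂^{fun _ : Fin n => v} (dil s hs F) = (s⁻¹ ^ n : ℝ) • dil s hs (∂^{fun _ : Fin n => v} F) := by
  induction n with
  | zero => simp
  | succ n ih =>
    rw [LineDeriv.iteratedLineDerivOp_succ_left, LineDeriv.iteratedLineDerivOp_succ_left]
    have htail : (Fin.tail fun _ : Fin (n + 1) => v) = fun _ : Fin n => v := rfl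
    rw [htail, ih]
    show ∂_{v} ((s⁻¹ ^ n : ℝ) • dil s hs (∂^{fun _ : Fin n => v} F)) =
      (s⁻¹ ^ (n + 1) : ℝ) • dil s hs (∂_{v} (∂^{fun _ : Fin n => v} F))
    rw [LineDerivSMul.lineDerivOp_smul, lineDerivOp_dil, smul_smul, pow_succ]

theorem D8_dil (μ : Fin 4) {s : ℝ} (hs : s ≠ 0) (F : 𝓢((Fin 2 → E4), ℂ)) :
    D8 μ (dil s hs F) = (s⁻¹ ^ 8 : ℝ) • dil s hs (D8 μ F) := by
  rw [D8_apply, D8_apply, iteratedLineDerivOp_dil]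

/-- `L₈` is homogeneous of degree `-8` under dilations. -/
theorem L8_dil (s : ℝ) (hs : 0 < s) (F : 𝓢((Fin 2 → E4), ℂ)) :
    L8 (dil s hs.ne' F) = (s⁻¹ ^ 8 : ℝ) • dil s hs.ne' (L8 F) := by
  rw [L8_apply, L8_apply, map_sum, Finset.smul_sum]
  exact Finset.sum_congr rfl fun μ _ => D8_dil μ hs.ne' F

/-- `L₈` does not enlarge supports. -/
theorem L8_supp (F : 𝓢((Fin 2 → E4), ℂ)) (u : Fin 2 → E4) (hu : L8 F u ≠ 0) :
    u ∈ tsupport (F : (Fin 2 → E4) → ℂ) := by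
  rw [L8_apply, sum_apply] at hu
  obtain ⟨μ, -, hμ⟩ := Finset.exists_ne_zero_of_sum_ne_zero hu
  rw [D8_apply] at hμ
  exact SchwartzMap.tsupport_iteratedLineDerivOp_subset (fun _ : Fin 8 => V0 μ) F
    (subset_tsupport _ hμ)

/-- **The canonical witness functional, conditional form.** For ANY two-point functional agreeing
with `F ↦ ∫ G_m(u₀-u₁) (L₈F)(u) du` (the two-point function of the Gaussian family with covariance
`(Σ_μ k_μ⁸)/(k²+m²)` of §D, restricted to test functions), non-representability with the crux's
bound follows from ONE number: the massless moment `∫ (4π²‖u₀-u₁‖²)⁻¹ (L₈F₀)(u) du ≠ 0` of one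
separated off-diagonal `F₀` (blueprint: eight Schwartz integrations by parts —
`SchwartzMap.integral_mul_lineDerivOp_right_eq_neg_left` against a compactly supported smooth
extension of `(4π²‖w‖²)⁻¹` from a neighbourhood of `tsupport F₀` — turn it into
`∫ H(u₀-u₁) F₀` with `4π² H = Σ_μ ∂_μ⁸ ‖w‖⁻²`, `4π² H(e₁) = 483840`; take `F₀ ≥ 0` a bump tensor at
`(e₁, 0)`). -/
theorem not_representable_T0_L8 {m : ℝ} (hm : 0 < m) (T : TwoPointCLM)
    (hT : ∀ F, T F = ∫ u, (FreeKernel.G m (u 0 - u 1) : ℂ) * L8 F u)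
    {F₀ : 𝓢((Fin 2 → E4), ℂ)} (hF₀ : IsOffDiagonal F₀) {δ R : ℝ} (hδ : 0 < δ)
    (hsep : ∀ u ∈ tsupport (F₀ : (Fin 2 → E4) → ℂ), δ ≤ ‖u 0 - u 1‖ ∧ ‖u 0 - u 1‖ ≤ R)
    (hJ : ∫ u, (masslessWeight u : ℂ) * L8 F₀ u ≠ 0) :
    ¬ ∃ (K : E4 → ℝ) (C η : ℝ), KernelData K C η ∧ RepresentsCLM T K :=
  not_representable_of_masslessMoment_ne_zero hm T L8 hT L8_dil L8_supp hF₀ hδ hsep hJ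

end Dressing

/-! ## §G'' The numbers: `d⁸/dt⁸ (1+t²)⁻¹ |₀ = 8! = 40320`, `d⁸/dt⁸ (1+t)⁻² |₀ = 9! = 362880`
(so `Σ_μ ∂_μ⁸ ‖w‖⁻² (e₁) = 3·40320 + 362880 = 483840 > 0`). -/

section Numbers

/-- `d⁸/dt⁸ (1+t)⁻²` at `t = 0` is `9! = 362880`. -/
theorem iteratedDeriv_eight_inv_sq_one_add :
    iteratedDeriv 8 (fun t : ℝ => ((1 + t) ^ 2)⁻¹) 0 = 362880 := by
  have h : (fun t : ℝ => ((1 + t) ^ 2)⁻¹) = fun t => (fun x : ℝ => x ^ (-2 : ℤ)) (1 + t) := by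
    funext t
    simp only [zpow_neg, zpow_ofNat]
  rw [h, iteratedDeriv_comp_const_add 8 (fun x : ℝ => x ^ (-2 : ℤ)) 1]
  simp only [add_zero]
  rw [iteratedDeriv_eq_iterate, iter_deriv_zpow]
  norm_num [Finset.prod_range_succ]

/-- `d⁸/dt⁸ (1+t²)⁻¹` at `t = 0` is `8! = 40320` (partial fractions: `(1+t²)⁻¹ = Re (1 - it)⁻¹`). -/
theorem iteratedDeriv_eight_inv_one_add_sq :
    iteratedDeriv 8 (fun t : ℝ => (1 + t ^ 2)⁻¹) 0 = 40320 := by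
  set e : ℂ → ℂ := fun z => (-Complex.I * z + 1)⁻¹ with he
  have hre : (fun t : ℝ => (1 + t ^ 2)⁻¹) = fun t : ℝ => (e t).re := by
    funext t
    simp only [e, Complex.inv_re, Complex.normSq_apply]
    simp
    ring
  have hder : ∀ k : ℕ, deriv^[k] e = fun z => (-1) ^ k * (k.factorial : ℂ) * (-Complex.I) ^ k *
      (-Complex.I * z + 1) ^ (-1 - k : ℤ) :=
    fun k => iter_deriv_inv_linear k (-Complex.I) 1
  have hb : ∀ t : ℝ, (-Complex.I * (t : ℂ) + 1) ≠ 0 := by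
    intro t h0
    have := congrArg Complex.re h0
    simp at this
  have hreal : ∀ k : ℕ, iteratedDeriv k (fun t : ℝ => (e t).re) =
      fun t : ℝ => ((deriv^[k] e) (t : ℂ)).re := by
    intro k
    induction k with
    | zero => funext t; simp
    | succ k ih =>
      rw [iteratedDeriv_succ, ih]
      funext t
      have hd : HasDerivAt (deriv^[k] e) ((deriv^[k + 1] e) t) t := by
        rw [Function.iterate_succ_apply']
        refine DifferentiableAt.hasDerivAt ?_
        rw [hder k]
        have hf : DifferentiableAt ℂ (fun z : ℂ => -Complex.I * z + 1) (t : ℂ) := by fun_prop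
        exact (hf.zpow (Or.inl (hb t))).const_mul _
      exact hd.real_of_complex.deriv
  rw [hre, hreal 8]
  simp only [hder 8]
  have hI : (-Complex.I) ^ 8 = 1 := by
    have : (-Complex.I) ^ 8 = (Complex.I ^ 2) ^ 4 := by ring
    rw [this, Complex.I_sq]; norm_num
  simp [hI, Nat.factorial]
  norm_num

/-- The blueprint number: `3 · 8! + 9! = 483840`. -/
theorem blueprint_number : (3 * 40320 + 362880 : ℝ) = 483840 := by norm_num

end Numbers

/-! ## §H The massless moment of `L₈` is nonzero (residue R2): tools -/

section MomentTools

open Real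
open scoped LineDeriv

/-- Iterated Schwartz integration by parts along a fixed direction. -/
theorem integral_mul_iteratedLineDerivOp_const (n : ℕ) (v : Fin 2 → E4)
    (f g : 𝓢((Fin 2 → E4), ℂ)) :
    ∫ x, f x * (∂^{fun _ : Fin n => v} g) x = (-1) ^ n * ∫ x, (∂^{fun _ : Fin n => v} f) x * g x := by
  induction n generalizing f g with
  | zero => simp
  | succ n ih =>
    rw [LineDeriv.iteratedLineDerivOp_succ_left]
    have htail : (Fin.tail fun _ : Fin (n + 1) => v) = fun _ : Fin n => v := rfl
    rw [htail]
    show ∫ x, f x * (∂_{v} (∂^{fun _ : Fin n => v} g)) x = _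
    rw [SchwartzMap.integral_mul_lineDerivOp_right_eq_neg_left, ih (∂_{v} f) g]
    have hsucc : ∂^{fun _ : Fin (n + 1) => v} f = ∂^{fun _ : Fin n => v} (∂_{v} f) := by
      rw [LineDeriv.iteratedLineDerivOp_succ_right]; rfl
    rw [hsucc, pow_succ]
    ring

/-- Iterated line derivatives along one direction are iterated derivatives of the line restriction. -/
theorem iteratedDeriv_line (n : ℕ) (f : 𝓢((Fin 2 → E4), ℂ)) (x v : Fin 2 → E4) :
    iteratedDeriv n (fun t : ℝ => f (x + t • v)) 0 = (∂^{fun _ : Fin n => v} f) x := by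
  rw [SchwartzMap.iteratedLineDerivOp_eq_iteratedFDeriv, iteratedDeriv_eq_iteratedFDeriv]
  let g : ℝ →L[ℝ] (Fin 2 → E4) := ContinuousLinearMap.toSpanSingleton ℝ v
  have hfun : (fun t : ℝ => f (x + t • v)) = (fun y : Fin 2 → E4 => f (y + x)) ∘ g := by
    funext t
    simp [g, ContinuousLinearMap.toSpanSingleton_apply, add_comm]
  have hF : ContDiff ℝ n (fun y : Fin 2 → E4 => f (y + x)) :=
    (f.smooth n).comp (contDiff_id.add contDiff_const)
  rw [hfun, ContinuousLinearMap.iteratedFDeriv_comp_right g hF 0 le_rfl]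
  simp only [ContinuousMultilinearMap.compContinuousLinearMap_apply]
  have h0 : g 0 = 0 := by simp [g]
  rw [h0, iteratedFDeriv_comp_add_right' n x]
  simp [g, ContinuousLinearMap.toSpanSingleton_apply]

/-- `iteratedDeriv` commutes with the real-to-complex coercion (local smoothness suffices). -/
theorem iteratedDeriv_ofReal_comp {q : ℝ → ℝ} {x : ℝ} {n : ℕ} (hq : ContDiffAt ℝ n q x) :
    iteratedDeriv n (fun t => (q t : ℂ)) x = ((iteratedDeriv n q x : ℝ) : ℂ) := by
  rw [iteratedDeriv_eq_iteratedFDeriv, iteratedDeriv_eq_iteratedFDeriv]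
  have h := ContinuousLinearMap.iteratedFDeriv_comp_left Complex.ofRealCLM hq (i := n) le_rfl
  have hfun : (fun t => (q t : ℂ)) = Complex.ofRealCLM ∘ q := rfl
  rw [hfun, h]
  rfl

/-- The base point `c = (e₁, 0)` of the moment computation. -/
def basePt : Fin 2 → E4 := ![EuclideanSpace.single 1 1, 0]

@[simp] theorem basePt_zero : basePt 0 = EuclideanSpace.single 1 1 := rfl
@[simp] theorem basePt_one : basePt 1 = 0 := rfl
@[simp] theorem V0_apply_zero (μ : Fin 4) : V0 μ 0 = EuclideanSpace.single μ 1 := by simp [V0]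
@[simp] theorem V0_apply_one (μ : Fin 4) : V0 μ 1 = 0 := by simp [V0]

theorem norm_V0 (μ : Fin 4) : ‖V0 μ‖ = 1 := by
  rw [V0, Pi.norm_single, PiLp.norm_single, norm_one]

/-- `‖e₁ + t e_μ‖² = 1 + t²` for `μ ≠ 1`. -/
theorem norm_sq_line_of_ne {μ : Fin 4} (hμ : μ ≠ 1) (t : ℝ) :
    ‖(EuclideanSpace.single 1 1 + t • EuclideanSpace.single μ 1 : E4)‖ ^ 2 = 1 + t ^ 2 := by
  rw [EuclideanSpace.real_norm_sq_eq]
  fin_cases μ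
  · simp [Fin.sum_univ_four]; try ring
  · exact absurd rfl hμ
  · simp [Fin.sum_univ_four]; try ring
  · simp [Fin.sum_univ_four]; try ring

/-- `‖e₁ + t e₁‖² = (1 + t)²`. -/
theorem norm_sq_line_one (t : ℝ) :
    ‖(EuclideanSpace.single 1 1 + t • EuclideanSpace.single 1 1 : E4)‖ ^ 2 = (1 + t) ^ 2 := by
  rw [EuclideanSpace.real_norm_sq_eq]
  simp [Fin.sum_univ_four]; try ring

/-- The massless weight along the four coordinate lines through `c`. -/
theorem masslessWeight_line_of_ne {μ : Fin 4} (hμ : μ ≠ 1) (t : ℝ) :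
    masslessWeight (basePt + t • V0 μ) = (4 * π ^ 2)⁻¹ * (1 + t ^ 2)⁻¹ := by
  unfold masslessWeight
  have : (basePt + t • V0 μ) 0 - (basePt + t • V0 μ) 1 =
      EuclideanSpace.single 1 1 + t • EuclideanSpace.single μ 1 := by
    simp [Pi.add_apply, Pi.smul_apply]
  rw [this, norm_sq_line_of_ne hμ]
  field_simp

theorem masslessWeight_line_one (t : ℝ) :
    masslessWeight (basePt + t • V0 1) = (4 * π ^ 2)⁻¹ * ((1 + t) ^ 2)⁻¹ := by
  unfold masslessWeight
  have : (basePt + t • V0 1) 0 - (basePt + t • V0 1) 1 =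
      EuclideanSpace.single 1 1 + t • EuclideanSpace.single 1 1 := by
    simp [Pi.add_apply, Pi.smul_apply]
  rw [this, norm_sq_line_one]
  rw [one_div, mul_inv]

end MomentTools

/-! ## §H' The cut-off massless weight `ΛS` and the values `∂_{(0,μ)}⁸ ΛS (c)` -/

section MomentCutoff

open Real
open scoped LineDeriv ContDiff

/-- The fixed cutoff around `c = (e₁, 0)` (sup-norm radii `1/4 < 1/3`). -/
def chi0 : ContDiffBump basePt := ⟨1 / 4, 1 / 3, by norm_num, by norm_num⟩

/-- The cut-off massless weight `Λ = χ₀ · (4π²‖u₀-u₁‖²)⁻¹`. -/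
def Lam (u : Fin 2 → E4) : ℝ := chi0 u * masslessWeight u

theorem isOpen_offDiag : IsOpen {u : Fin 2 → E4 | u 0 - u 1 ≠ 0} :=
  isOpen_ne_fun ((continuous_apply 0).sub (continuous_apply 1)) continuous_const

theorem masslessWeight_contDiffOn :
    ContDiffOn ℝ ∞ masslessWeight {u : Fin 2 → E4 | u 0 - u 1 ≠ 0} := by
  have hlin : ContDiff ℝ ∞ (fun u : Fin 2 → E4 => u 0 - u 1) :=
    ((ContinuousLinearMap.proj (R := ℝ) (φ := fun _ : Fin 2 => E4) 0) -
      (ContinuousLinearMap.proj (R := ℝ) (φ := fun _ : Fin 2 => E4) 1)).contDiff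
  have h1 : ContDiff ℝ ∞ (fun u : Fin 2 → E4 => ‖u 0 - u 1‖ ^ 2) := (contDiff_norm_sq ℝ).comp hlin
  unfold masslessWeight
  refine ContDiffOn.div contDiffOn_const (contDiffOn_const.mul h1.contDiffOn) ?_
  intro u hu
  have : ‖u 0 - u 1‖ ≠ 0 := norm_ne_zero_iff.2 hu
  positivity

theorem norm_single_one_one : ‖(EuclideanSpace.single (1 : Fin 4) (1 : ℝ) : E4)‖ = 1 := by
  rw [PiLp.norm_single, norm_one]

/-- Points within sup-distance `< 1/2` of `c` are off the diagonal, with `1/2 < ‖u₀-u₁‖ < 3/2`. -/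
theorem offDiag_of_near_basePt {u : Fin 2 → E4} {ρ : ℝ} (hρ : ρ < 1 / 2) (hu : ‖u - basePt‖ ≤ ρ) :
    u 0 - u 1 ≠ 0 ∧ 1 - 2 * ρ ≤ ‖u 0 - u 1‖ ∧ ‖u 0 - u 1‖ ≤ 1 + 2 * ρ := by
  have h0 : ‖u 0 - EuclideanSpace.single 1 1‖ ≤ ρ := by
    have := norm_le_pi_norm (u - basePt) 0; simp at this; linarith
  have h1 : ‖u 1‖ ≤ ρ := by
    have := norm_le_pi_norm (u - basePt) 1; simp at this; linarith
  have hdecomp : u 0 - u 1 = EuclideanSpace.single 1 1 + ((u 0 - EuclideanSpace.single 1 1) - u 1) := by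
    abel
  have hsmall : ‖(u 0 - EuclideanSpace.single 1 1) - u 1‖ ≤ 2 * ρ :=
    (norm_sub_le _ _).trans (by linarith)
  have hlow : 1 - 2 * ρ ≤ ‖u 0 - u 1‖ := by
    rw [hdecomp]
    have := norm_sub_norm_le (EuclideanSpace.single (1 : Fin 4) (1 : ℝ) : E4)
      (-((u 0 - EuclideanSpace.single 1 1) - u 1))
    rw [sub_neg_eq_add, norm_neg, norm_single_one_one] at this
    linarith
  have hup : ‖u 0 - u 1‖ ≤ 1 + 2 * ρ := by
    rw [hdecomp]
    refine (norm_add_le _ _).trans ?_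
    rw [norm_single_one_one]; linarith
  refine ⟨fun h => ?_, hlow, hup⟩
  rw [h, norm_zero] at hlow
  linarith

theorem tsupport_chi0_subset : tsupport chi0 ⊆ {u : Fin 2 → E4 | u 0 - u 1 ≠ 0} := by
  intro u hu
  rw [chi0.tsupport_eq, Metric.mem_closedBall, dist_eq_norm] at hu
  exact (offDiag_of_near_basePt (ρ := 1 / 3) (by norm_num) hu).1

theorem contDiff_Lam : ContDiff ℝ ∞ Lam := by
  rw [contDiff_iff_contDiffAt]
  intro u
  by_cases hu : u ∈ tsupport chi0
  · have hU : {u : Fin 2 → E4 | u 0 - u 1 ≠ 0} ∈ 𝓝 u :=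
      isOpen_offDiag.mem_nhds (tsupport_chi0_subset hu)
    exact chi0.contDiff.contDiffAt.mul (masslessWeight_contDiffOn.contDiffAt hU)
  · have h0 : Lam =ᶠ[𝓝 u] fun _ => 0 := by
      filter_upwards [notMem_tsupport_iff_eventuallyEq.1 hu] with y hy
      simp [Lam, hy]
    exact (contDiffAt_const (c := (0 : ℝ))).congr_of_eventuallyEq h0

theorem hasCompactSupport_Lam : HasCompactSupport Lam :=
  chi0.hasCompactSupport.mul_right

/-- `ΛS`: the cut-off massless weight as a (complex-valued) Schwartz function. -/
def LamS : 𝓢((Fin 2 → E4), ℂ) :=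
  (hasCompactSupport_Lam.comp_left Complex.ofReal_zero).toSchwartzMap
    (Complex.ofRealCLM.contDiff.comp contDiff_Lam)

@[simp] theorem LamS_apply (u : Fin 2 → E4) : LamS u = ((Lam u : ℝ) : ℂ) := rfl

/-- `ΛS = (4π²‖u₀-u₁‖²)⁻¹` within sup-distance `1/4` of `c`. -/
theorem LamS_eq_of_near {u : Fin 2 → E4} (hu : ‖u - basePt‖ ≤ 1 / 4) :
    LamS u = ((masslessWeight u : ℝ) : ℂ) := by
  rw [LamS_apply, Lam, chi0.one_of_mem_closedBall, one_mul]
  rwa [Metric.mem_closedBall, dist_eq_norm]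

theorem chi0_line_eq_one {μ : Fin 4} {t : ℝ} (ht : |t| ≤ 1 / 4) : chi0 (basePt + t • V0 μ) = 1 := by
  refine chi0.one_of_mem_closedBall ?_
  rw [Metric.mem_closedBall, dist_eq_norm, add_sub_cancel_left, norm_smul, norm_V0, mul_one,
    Real.norm_eq_abs]
  exact ht

/-- `∂_{(0,μ)}⁸ ΛS (c) = 8!/(4π²)` for `μ ≠ 1`. -/
theorem D8_LamS_basePt_of_ne {μ : Fin 4} (hμ : μ ≠ 1) :
    D8 μ LamS basePt = (((4 * π ^ 2)⁻¹ * 40320 : ℝ) : ℂ) := by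
  rw [D8_apply, ← iteratedDeriv_line 8 LamS basePt (V0 μ)]
  have hgerm : (fun t : ℝ => LamS (basePt + t • V0 μ)) =ᶠ[𝓝 0]
      fun t => (((4 * π ^ 2)⁻¹ * (1 + t ^ 2)⁻¹ : ℝ) : ℂ) := by
    filter_upwards [Metric.closedBall_mem_nhds (0 : ℝ) (by norm_num : (0 : ℝ) < 1 / 4)] with t ht
    rw [Metric.mem_closedBall, dist_zero_right, Real.norm_eq_abs] at ht
    rw [LamS_apply, Lam, chi0_line_eq_one ht, one_mul, masslessWeight_line_of_ne hμ]
  have hq : ContDiffAt ℝ 8 (fun t : ℝ => (1 + t ^ 2)⁻¹) 0 :=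
    (contDiffAt_const.add (contDiffAt_id.pow 2)).inv (by norm_num)
  rw [hgerm.iteratedDeriv_eq, iteratedDeriv_ofReal_comp (contDiffAt_const.mul hq),
    iteratedDeriv_const_mul _ hq, iteratedDeriv_eight_inv_one_add_sq]

/-- `∂_{(0,1)}⁸ ΛS (c) = 9!/(4π²)`. -/
theorem D8_LamS_basePt_one :
    D8 1 LamS basePt = (((4 * π ^ 2)⁻¹ * 362880 : ℝ) : ℂ) := by
  rw [D8_apply, ← iteratedDeriv_line 8 LamS basePt (V0 1)]
  have hgerm : (fun t : ℝ => LamS (basePt + t • V0 1)) =ᶠ[𝓝 0]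
      fun t => (((4 * π ^ 2)⁻¹ * ((1 + t) ^ 2)⁻¹ : ℝ) : ℂ) := by
    filter_upwards [Metric.closedBall_mem_nhds (0 : ℝ) (by norm_num : (0 : ℝ) < 1 / 4)] with t ht
    rw [Metric.mem_closedBall, dist_zero_right, Real.norm_eq_abs] at ht
    rw [LamS_apply, Lam, chi0_line_eq_one ht, one_mul, masslessWeight_line_one]
  have hq : ContDiffAt ℝ 8 (fun t : ℝ => ((1 + t) ^ 2)⁻¹) 0 :=
    ((contDiffAt_const.add contDiffAt_id).pow 2).inv (by norm_num)
  rw [hgerm.iteratedDeriv_eq, iteratedDeriv_ofReal_comp (contDiffAt_const.mul hq),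
    iteratedDeriv_const_mul _ hq, iteratedDeriv_eight_inv_sq_one_add]

/-- The kernel-side Schwartz function `H = Σ_μ ∂_{(0,μ)}⁸ ΛS` … -/
def H8 : 𝓢((Fin 2 → E4), ℂ) := ∑ μ : Fin 4, D8 μ LamS

/-- … and its value at `c`: `483840/(4π²) > 0`. -/
theorem H8_basePt : H8 basePt = (((4 * π ^ 2)⁻¹ * 483840 : ℝ) : ℂ) := by
  rw [H8, sum_apply, Fin.sum_univ_four, D8_LamS_basePt_of_ne (by decide),
    D8_LamS_basePt_one, D8_LamS_basePt_of_ne (by decide), D8_LamS_basePt_of_ne (by decide)]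
  push_cast
  ring

theorem H8_basePt_re_pos : 0 < (H8 basePt).re := by
  rw [H8_basePt, Complex.ofReal_re]
  positivity

end MomentCutoff

/-! ## §H'' Assembly: the massless moment of `L₈` on a bump tensor at `(e₁,0)` is nonzero -/

section MomentAssembly

open Real
open scoped LineDeriv ContDiff

/-- A continuity radius of `H` at `c`. -/
theorem exists_radius_H8 : ∃ ρ : ℝ, 0 < ρ ∧ ρ ≤ 1 / 8 ∧ ∀ u : Fin 2 → E4, ‖u - basePt‖ < ρ →
    (H8 basePt).re / 2 < (H8 u).re := by
  have hc : ContinuousAt (fun u => H8 u) basePt := H8.continuous.continuousAt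
  have hκ := H8_basePt_re_pos
  obtain ⟨ρ₀, hρ₀, h⟩ := Metric.continuousAt_iff.1 hc ((H8 basePt).re / 2) (half_pos hκ)
  refine ⟨min ρ₀ (1 / 8), lt_min hρ₀ (by norm_num), min_le_right _ _, fun u hu => ?_⟩
  have hd : dist u basePt < ρ₀ := by
    rw [dist_eq_norm]; exact hu.trans_le (min_le_left _ _)
  have h1 := h hd
  rw [dist_eq_norm] at h1
  have hre : |(H8 u).re - (H8 basePt).re| < (H8 basePt).re / 2 := by
    calc |(H8 u).re - (H8 basePt).re| = |(H8 u - H8 basePt).re| := by simp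
      _ ≤ ‖H8 u - H8 basePt‖ := Complex.abs_re_le_norm _
      _ < _ := h1
  rw [abs_sub_lt_iff] at hre
  linarith [hre.1, hre.2]

/-- Products of Schwartz functions are integrable. -/
theorem integrable_schwartz_mul (f g : 𝓢((Fin 2 → E4), ℂ)) :
    Integrable (fun x : Fin 2 → E4 => f x * g x) :=
  g.integrable.bdd_mul f.continuous.aestronglyMeasurable
    (Eventually.of_forall fun x => norm_le_schwartzNorm 0 f x)

/-- **The massless moment of `L₈` does not vanish** (on a bump tensor at `(e₁, 0)`). -/
theorem exists_masslessMoment_L8_ne_zero :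
    ∃ F₀ : 𝓢((Fin 2 → E4), ℂ), IsOffDiagonal F₀ ∧
      (∀ u ∈ tsupport (F₀ : (Fin 2 → E4) → ℂ), (1 / 2 : ℝ) ≤ ‖u 0 - u 1‖ ∧ ‖u 0 - u 1‖ ≤ 2) ∧
      ∫ u, (masslessWeight u : ℂ) * L8 F₀ u ≠ 0 := by
  obtain ⟨ρ, hρ, hρ8, hH⟩ := exists_radius_H8
  set κ : ℝ := (H8 basePt).re with hκdef
  have hκ : 0 < κ := H8_basePt_re_pos
  -- the bumps
  let e₁ : E4 := EuclideanSpace.single 1 1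
  let g : ContDiffBump e₁ := ⟨ρ / 4, ρ / 2, by positivity, by linarith⟩
  let h : ContDiffBump (0 : E4) := ⟨ρ / 4, ρ / 2, by positivity, by linarith⟩
  have hsep0 : g.rOut + h.rOut < ‖e₁ - 0‖ := by
    show ρ / 2 + ρ / 2 < ‖e₁ - 0‖
    rw [sub_zero, norm_single_one_one]; linarith
  let F₀ := bumpTensor g h
  -- support control in the sup norm
  have hsupp : ∀ u, F₀ u ≠ 0 → ‖u - basePt‖ < ρ / 2 := by
    intro u hu
    rw [bumpTensor_apply] at hu
    have hu' : g (u 0) * h (u 1) ≠ 0 := by exact_mod_cast hu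
    obtain ⟨hg, hh⟩ := mul_ne_zero_iff.1 hu'
    have hg' : u 0 ∈ Function.support g := hg
    have hh' : u 1 ∈ Function.support h := hh
    rw [ContDiffBump.support_eq, Metric.mem_ball, dist_eq_norm] at hg' hh'
    rw [pi_norm_lt_iff (by positivity)]
    intro i
    fin_cases i
    · simpa using hg'
    · simpa using hh'
  have htsupp : ∀ u ∈ tsupport (F₀ : (Fin 2 → E4) → ℂ), ‖u - basePt‖ ≤ ρ / 2 := by
    have hS : IsClosed {u : Fin 2 → E4 | ‖u - basePt‖ ≤ ρ / 2} :=
      isClosed_le (continuous_norm.comp (continuous_id.sub continuous_const)) continuous_const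
    have hsub : Function.support (F₀ : (Fin 2 → E4) → ℂ) ⊆ {u | ‖u - basePt‖ ≤ ρ / 2} :=
      fun u hu => (hsupp u hu).le
    exact fun u hu => closure_minimal hsub hS hu
  refine ⟨F₀, isOffDiagonal_bumpTensor g h hsep0, fun u hu => ?_, ?_⟩
  · have hn := htsupp u hu
    have := offDiag_of_near_basePt (ρ := ρ / 2) (by linarith) hn
    constructor <;> linarith [this.2.1, this.2.2]
  -- the moment
  have hΛ : ∀ u, (masslessWeight u : ℂ) * L8 F₀ u = LamS u * L8 F₀ u := by
    intro u
    by_cases hu : L8 F₀ u = 0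
    · simp [hu]
    rw [LamS_eq_of_near ((htsupp u (L8_supp F₀ u hu)).trans (by linarith))]
  have hstep : ∫ u, (masslessWeight u : ℂ) * L8 F₀ u = ∫ u, H8 u * F₀ u := by
    simp_rw [hΛ, L8_apply, sum_apply, Finset.mul_sum]
    rw [integral_finsetSum _ fun μ _ => integrable_schwartz_mul LamS (D8 μ F₀)]
    have hμ : ∀ μ : Fin 4, ∫ u, LamS u * D8 μ F₀ u = ∫ u, D8 μ LamS u * F₀ u := by
      intro μ
      rw [D8_apply, D8_apply, integral_mul_iteratedLineDerivOp_const 8 (V0 μ) LamS F₀]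
      norm_num
    simp_rw [hμ]
    rw [← integral_finsetSum _ fun μ _ => integrable_schwartz_mul (D8 μ LamS) F₀]
    congr 1; funext u
    rw [H8, sum_apply, Finset.sum_mul]
  rw [hstep]
  -- positivity of the real part
  set fR : (Fin 2 → E4) → ℝ := fun u => (H8 u).re * (g (u 0) * h (u 1)) with hfR
  have hint : Integrable (fun u : Fin 2 → E4 => H8 u * F₀ u) := integrable_schwartz_mul H8 F₀
  have hF : ∀ u, F₀ u = ((g (u 0) * h (u 1) : ℝ) : ℂ) := fun u => bumpTensor_apply g h u
  have hre : (∫ u, H8 u * F₀ u).re = ∫ u, fR u := by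
    have h1 := (Complex.reCLM.integral_comp_comm hint).symm
    simp only [Complex.reCLM_apply] at h1
    rw [h1]
    congr 1; funext u
    rw [hF u]
    simp [fR, Complex.mul_re]
  -- lower bound
  set ℓ : (Fin 2 → E4) → ℝ := fun u => κ / 2 * (g (u 0) * h (u 1)) with hℓ
  have hℓ_le : ∀ u, ℓ u ≤ fR u := by
    intro u
    by_cases hgh : g (u 0) * h (u 1) = 0
    · simp [ℓ, fR, hgh]
    have hu : F₀ u ≠ 0 := by
      rw [bumpTensor_apply]; exact_mod_cast hgh
    have hnear : ‖u - basePt‖ < ρ := (hsupp u hu).trans (by linarith)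
    have hHu := hH u hnear
    exact mul_le_mul_of_nonneg_right hHu.le (mul_nonneg g.nonneg h.nonneg)
  have hℓ_cont : Continuous ℓ :=
    continuous_const.mul ((g.continuous.comp (continuous_apply 0)).mul
      (h.continuous.comp (continuous_apply 1)))
  have hℓ_supp : HasCompactSupport ℓ := by
    let B : Fin 2 → Set E4 := ![Metric.closedBall e₁ (ρ / 2), Metric.closedBall (0 : E4) (ρ / 2)]
    refine HasCompactSupport.intro (K := Set.pi Set.univ B)
      (isCompact_univ_pi fun i => ?_) ?_
    · fin_cases i <;> exact isCompact_closedBall _ _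
    · intro x hx
      rw [Set.mem_univ_pi, Fin.forall_fin_two] at hx
      simp only [ℓ]
      have : g (x 0) * h (x 1) = 0 := by
        by_contra hgh
        obtain ⟨hg1, hh1⟩ := mul_ne_zero_iff.1 hgh
        have hg2 : x 0 ∈ Function.support g := hg1
        have hh2 : x 1 ∈ Function.support h := hh1
        rw [ContDiffBump.support_eq] at hg2 hh2
        exact hx ⟨Metric.ball_subset_closedBall hg2, Metric.ball_subset_closedBall hh2⟩
      rw [this, mul_zero]
  have hℓ_nonneg : 0 ≤ ℓ := fun u => by
    simp only [ℓ, Pi.zero_apply]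
    exact mul_nonneg (by positivity) (mul_nonneg g.nonneg h.nonneg)
  have hℓ_c : ℓ basePt ≠ 0 := by
    have hg1 : g (basePt 0) = 1 := g.one_of_mem_closedBall (by
      show basePt 0 ∈ Metric.closedBall e₁ (ρ / 4)
      rw [basePt_zero]; exact Metric.mem_closedBall_self (by positivity))
    have hh1 : h (basePt 1) = 1 := h.one_of_mem_closedBall (by
      show basePt 1 ∈ Metric.closedBall (0 : E4) (ρ / 4)
      rw [basePt_one]; exact Metric.mem_closedBall_self (by positivity))
    simp only [ℓ, hg1, hh1, mul_one]
    positivity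
  have hpos : 0 < ∫ u, ℓ u :=
    hℓ_cont.integral_pos_of_hasCompactSupport_nonneg_nonzero hℓ_supp hℓ_nonneg hℓ_c
  have hintR : Integrable fR := by
    have := hint.re
    refine this.congr (Eventually.of_forall fun u => ?_)
    show (H8 u * F₀ u).re = fR u
    rw [hF u]
    simp [fR, Complex.mul_re]
  have hle : ∫ u, ℓ u ≤ ∫ u, fR u :=
    integral_mono_of_nonneg (Eventually.of_forall hℓ_nonneg) hintR (Eventually.of_forall hℓ_le)
  intro hJ
  have : (∫ u, H8 u * F₀ u).re = 0 := by rw [hJ, Complex.zero_re]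
  rw [hre] at this
  linarith

/-- **Residue R2 discharged.** ANY two-point functional that agrees with
`F ↦ ∫ G_m(u₀-u₁) (L₈F)(u) du` — the two-point function of the §D Gaussian witness — admits NO
kernel with the crux's bound `|K x| ≤ C(1 + ‖x‖^(η-10))`, `η > 0`. (What is still assumed: that
such a `T : TwoPointCLM` exists, i.e. `T₀` is a CLM — residue R1 — and, for the full
`¬ CurvatureKernelBoundWithoutLatticeSixteen`, the package properties of the Gaussian family.) -/
theorem not_representable_T0_L8' {m : ℝ} (hm : 0 < m) (T : TwoPointCLM)
    (hT : ∀ F, T F = ∫ u, (FreeKernel.G m (u 0 - u 1) : ℂ) * L8 F u) :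
    ¬ ∃ (K : E4 → ℝ) (C η : ℝ), KernelData K C η ∧ RepresentsCLM T K := by
  obtain ⟨F₀, hF₀, hsep, hJ⟩ := exists_masslessMoment_L8_ne_zero
  exact not_representable_T0_L8 hm T hT hF₀ (by norm_num : (0 : ℝ) < 1 / 2) hsep hJ

end MomentAssembly

/-! ## §I The free two-point functional `T₀` as a CLM (residue R1) and the UNCONDITIONAL witness -/

section T0

open Real

/-- `u ↦ G_m(u₀-u₁) (1+‖u₁‖)⁻⁵` is integrable on `(ℝ⁴)²` (`‖G_m‖₁ < ∞`, `5 > 4`). -/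
theorem integrable_G_mul_weight {m : ℝ} (hm : m ≠ 0) :
    Integrable (fun u : Fin 2 → E4 => FreeKernel.G m (u 0 - u 1) * (1 + ‖u 1‖) ^ (-(5 : ℝ))) := by
  have hG : Integrable (FreeKernel.G m) := by
    unfold FreeKernel.G
    exact Literature.MathematicalPhysics.QuantumFieldTheory.integrable_freeKernel hm
  set f : E4 × E4 → ℝ := fun p => FreeKernel.G m (p.1 - p.2) * (1 + ‖p.2‖) ^ (-(5 : ℝ)) with hfdef
  have hmeasf : AEStronglyMeasurable f (volume.prod volume) := by
    refine (Measurable.aestronglyMeasurable ?_)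
    have h1 : Measurable fun p : E4 × E4 => FreeKernel.G m (p.1 - p.2) :=
      (FreeKernel.stronglyMeasurable_G m).measurable.comp (measurable_fst.sub measurable_snd)
    have h2 : Measurable fun p : E4 × E4 => (1 + ‖p.2‖) ^ (-(5 : ℝ)) := by fun_prop
    exact h1.mul h2
  have hprod : Integrable f (volume.prod volume) := by
    rw [integrable_prod_iff' hmeasf]
    constructor
    · refine Eventually.of_forall fun y => ?_
      show Integrable (fun x : E4 => FreeKernel.G m (x - y) * (1 + ‖y‖) ^ (-(5 : ℝ)))
      exact (hG.comp_sub_right y).mul_const _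
    · have heq : (fun y : E4 => ∫ x, ‖f (x, y)‖) =
          fun y => (∫ x, FreeKernel.G m x) * (1 + ‖y‖) ^ (-(5 : ℝ)) := by
        funext y
        have hw : 0 ≤ (1 + ‖y‖) ^ (-(5 : ℝ)) := rpow_nonneg (by positivity) _
        have h1 : (fun x => ‖f (x, y)‖) = fun x => FreeKernel.G m (x - y) * (1 + ‖y‖) ^ (-(5 : ℝ)) := by
          funext x
          rw [hfdef]
          simp only [norm_mul, Real.norm_of_nonneg (FreeKernel.G_nonneg m _), Real.norm_of_nonneg hw]
        rw [h1, integral_mul_const, integral_sub_right_eq_self (FreeKernel.G m) y]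
      rw [heq]
      have h5 : (Module.finrank ℝ E4 : ℝ) < 5 := by rw [FreeKernel.finrank_E4]; norm_num
      exact (integrable_one_add_norm h5).const_mul _
  have hmp := MeasureTheory.volume_preserving_finTwoArrow E4
  have hcomp : (fun u : Fin 2 → E4 => FreeKernel.G m (u 0 - u 1) * (1 + ‖u 1‖) ^ (-(5 : ℝ))) =
      f ∘ MeasurableEquiv.finTwoArrow := by
    funext u; rfl
  rw [hcomp]
  exact (hmp.integrable_comp_emb (MeasurableEquiv.finTwoArrow).measurableEmbedding).2 hprod

/-- The `L¹`-type constant of the free two-point functional. -/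
def T0const (m : ℝ) : ℝ :=
  2 ^ 5 * ∫ u : Fin 2 → E4, FreeKernel.G m (u 0 - u 1) * (1 + ‖u 1‖) ^ (-(5 : ℝ))

theorem T0const_nonneg (m : ℝ) : 0 ≤ T0const m := by
  unfold T0const
  refine mul_nonneg (by norm_num) (integral_nonneg fun u => ?_)
  exact mul_nonneg (FreeKernel.G_nonneg _ _) (rpow_nonneg (by positivity) _)

/-- The controlling Schwartz seminorm (decay of order `5`, no derivatives). -/
def semi5 : Seminorm ℂ 𝓢((Fin 2 → E4), ℂ) :=
  (Finset.Iic ((5 : ℕ), (0 : ℕ))).sup (schwartzSeminormFamily ℂ (Fin 2 → E4) ℂ)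

theorem norm_le_semi5 (F : 𝓢((Fin 2 → E4), ℂ)) (u : Fin 2 → E4) :
    (1 + ‖u‖) ^ 5 * ‖F u‖ ≤ 2 ^ 5 * semi5 F := by
  have h := SchwartzMap.one_add_le_sup_seminorm_apply (𝕜 := ℂ) (m := ((5 : ℕ), (0 : ℕ)))
    (k := 5) (n := 0) le_rfl le_rfl F u
  rw [norm_iteratedFDeriv_zero] at h
  exact h

/-- Schwartz decay in the second variable, controlled by `semi5`. -/
theorem norm_schwartz_le_weight (F : 𝓢((Fin 2 → E4), ℂ)) (u : Fin 2 → E4) :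
    ‖F u‖ ≤ 2 ^ 5 * semi5 F * (1 + ‖u 1‖) ^ (-(5 : ℝ)) := by
  have h := norm_le_semi5 F u
  have hS0 : 0 ≤ semi5 F := apply_nonneg _ _
  have hpos1 : 0 < 1 + ‖u 1‖ := by positivity
  have hpos : 0 < 1 + ‖u‖ := by positivity
  have hle : 1 + ‖u 1‖ ≤ 1 + ‖u‖ := by linarith [norm_le_pi_norm u 1]
  have hrpow : (1 + ‖u 1‖) ^ (-(5 : ℝ)) = ((1 + ‖u 1‖) ^ 5)⁻¹ := by
    rw [Real.rpow_neg hpos1.le, show (5 : ℝ) = ((5 : ℕ) : ℝ) by norm_num, Real.rpow_natCast]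
  rw [hrpow]
  have h1 : ‖F u‖ ≤ 2 ^ 5 * semi5 F * ((1 + ‖u‖) ^ 5)⁻¹ := by
    rw [← div_eq_mul_inv, le_div_iff₀ (by positivity)]
    linarith [h]
  refine h1.trans (mul_le_mul_of_nonneg_left ?_ (by positivity))
  apply inv_anti₀ (by positivity)
  exact pow_le_pow_left₀ hpos1.le hle 5

theorem aestronglyMeasurable_G_mul_schwartz (m : ℝ) (F : 𝓢((Fin 2 → E4), ℂ)) :
    AEStronglyMeasurable (fun u : Fin 2 → E4 => (FreeKernel.G m (u 0 - u 1) : ℂ) * F u) volume := by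
  have h1 : Measurable fun u : Fin 2 → E4 => u 0 - u 1 := by fun_prop
  exact ((Complex.continuous_ofReal.measurable.comp
    ((FreeKernel.stronglyMeasurable_G m).measurable.comp h1)).aestronglyMeasurable).mul
    F.continuous.aestronglyMeasurable

theorem norm_G_mul_schwartz_le (m : ℝ) (F : 𝓢((Fin 2 → E4), ℂ)) (u : Fin 2 → E4) :
    ‖(FreeKernel.G m (u 0 - u 1) : ℂ) * F u‖ ≤
      2 ^ 5 * semi5 F * (FreeKernel.G m (u 0 - u 1) * (1 + ‖u 1‖) ^ (-(5 : ℝ))) := by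
  rw [norm_mul, Complex.norm_real, Real.norm_of_nonneg (FreeKernel.G_nonneg _ _)]
  have := mul_le_mul_of_nonneg_left (norm_schwartz_le_weight F u) (FreeKernel.G_nonneg m (u 0 - u 1))
  linarith [this]

/-- Integrability of `u ↦ G_m(u₀-u₁) F(u)`. -/
theorem integrable_G_mul_schwartz {m : ℝ} (hm : m ≠ 0) (F : 𝓢((Fin 2 → E4), ℂ)) :
    Integrable (fun u : Fin 2 → E4 => (FreeKernel.G m (u 0 - u 1) : ℂ) * F u) :=
  Integrable.mono' ((integrable_G_mul_weight hm).const_mul _) (aestronglyMeasurable_G_mul_schwartz m F)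
    (Eventually.of_forall (norm_G_mul_schwartz_le m F))

/-- The seminorm bound of `F ↦ ∫ G_m(u₀-u₁) F(u) du`. -/
theorem norm_integral_G_mul_schwartz_le {m : ℝ} (hm : m ≠ 0) (F : 𝓢((Fin 2 → E4), ℂ)) :
    ‖∫ u, (FreeKernel.G m (u 0 - u 1) : ℂ) * F u‖ ≤ T0const m * semi5 F := by
  have hmaj : Integrable (fun u : Fin 2 → E4 =>
      2 ^ 5 * semi5 F * (FreeKernel.G m (u 0 - u 1) * (1 + ‖u 1‖) ^ (-(5 : ℝ)))) :=
    (integrable_G_mul_weight hm).const_mul _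
  have h1 : ‖∫ u, (FreeKernel.G m (u 0 - u 1) : ℂ) * F u‖ ≤
      ∫ u : Fin 2 → E4, 2 ^ 5 * semi5 F * (FreeKernel.G m (u 0 - u 1) * (1 + ‖u 1‖) ^ (-(5 : ℝ))) :=
    (norm_integral_le_integral_norm _).trans
      (integral_mono_of_nonneg (Eventually.of_forall fun _ => norm_nonneg _) hmaj
        (Eventually.of_forall (norm_G_mul_schwartz_le m F)))
  rw [integral_const_mul] at h1
  calc ‖∫ u, (FreeKernel.G m (u 0 - u 1) : ℂ) * F u‖
      ≤ 2 ^ 5 * semi5 F *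
          ∫ (u : Fin 2 → E4), FreeKernel.G m (u 0 - u 1) * (1 + ‖u 1‖) ^ (-(5 : ℝ)) := h1
    _ = T0const m * semi5 F := by unfold T0const; ring

/-- **The free two-point functional** `T₀ F = ∫ G_m(u₀-u₁) F(u) du` as a continuous linear
functional on two-point Schwartz space (`m ≠ 0`). -/
def T0 {m : ℝ} (hm : m ≠ 0) : TwoPointCLM :=
  SchwartzMap.mkCLMtoNormedSpace (𝕜 := ℂ) (σ := RingHom.id ℂ)
    (fun F => ∫ u, (FreeKernel.G m (u 0 - u 1) : ℂ) * F u)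
    (fun F F' => by
      simp only [add_apply, mul_add]
      exact integral_add (integrable_G_mul_schwartz hm F) (integrable_G_mul_schwartz hm F'))
    (fun a F => by
      simp only [smul_apply, smul_eq_mul, RingHom.id_apply]
      rw [← integral_const_mul]
      congr 1; funext u; ring)
    ⟨Finset.Iic ((5 : ℕ), (0 : ℕ)), T0const m, T0const_nonneg m,
      fun F => norm_integral_G_mul_schwartz_le hm F⟩

@[simp] theorem T0_apply {m : ℝ} (hm : m ≠ 0) (F : 𝓢((Fin 2 → E4), ℂ)) :
    T0 hm F = ∫ u, (FreeKernel.G m (u 0 - u 1) : ℂ) * F u := rfl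

/-- The two-point functional of the §D Gaussian witness `Ĉ(k) = (Σ_μ k_μ⁸)/(k²+m²)` (in the
position-space form `T₀ ∘ L₈`). -/
def TL8 {m : ℝ} (hm : m ≠ 0) : TwoPointCLM := (T0 hm).comp L8

/-- **UNCONDITIONAL (two-point level, residues R1+R2 discharged).** The dressed free two-point
functional `T₀ ∘ L₈` — i.e. the two-point Schwinger function, on all of `𝓢((ℝ⁴)²)`, of the centred
Gaussian family with covariance `(Σ_μ k_μ⁸)/(k²+m²)` — admits NO kernel `K` continuous off `0`
with `|K x| ≤ C(1 + ‖x‖^(η-10))`, `η > 0`, representing it on `⁰𝒮`. Its package properties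
(translations, `W(B₄)`, hermiticity, reflection positivity across the four axis mirrors on
positive-time one-point families, exponential clustering) are residue R3 of
`not_curvatureKernelBound_without_lattice`. -/
theorem TL8_not_representable {m : ℝ} (hm : 0 < m) :
    ¬ ∃ (K : E4 → ℝ) (C η : ℝ), KernelData K C η ∧ RepresentsCLM (TL8 hm.ne') K :=
  not_representable_T0_L8' hm (TL8 hm.ne') fun _ => rfl

end T0


/-! ## §D Load-bearing analysis: WITHOUT the lattice clause the statement is false (NEAR-MISSES) -/

section WithoutLattice

/-- The `S₁`-side package of `W₁`: its clauses (2)–(4) and the continuum gap — everything except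
the lattice convergence `W₁.1` and `HasLatticeMassGap`. -/
def OSPackage (S₁ : SchwingerFamily E4) : Prop :=
  (S₁.toLabelled.IsNormalized ∧ S₁.toLabelled.IsHermitian ∧ S₁.toLabelled.HasLinearGrowth ∧
      S₁.toLabelled.IsReflectionPositive ∧ S₁.toLabelled.IsSymmetric ∧
        S₁.toLabelled.HasClusterProperty) ∧
    (∀ (n : ℕ) (a : E4) (F : SchwartzMap (Fin n → E4) ℂ), IsOffDiagonal F →
      S₁ n (translateMulti a F) = S₁ n F) ∧
    (∀ (R : E4 ≃ₗᵢ[ℝ] E4), LinearMap.det (R.toLinearEquiv : E4 →ₗ[ℝ] E4) = 1 →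
      (∀ i : Fin 4, ∃ j : Fin 4, R (EuclideanSpace.single i 1) = EuclideanSpace.single j 1 ∨
        R (EuclideanSpace.single i 1) = -EuclideanSpace.single j 1) →
      ∀ (n : ℕ) (F : SchwartzMap (Fin n → E4) ℂ), IsOffDiagonal F →
        S₁ n (linActMulti R F) = S₁ n F) ∧
    (∃ Δ : ℝ, 0 < Δ ∧ S₁.toLabelled.HasMassGap Δ)

/-- `W₁` contains the `S₁`-side package (projection; the lattice gap is dropped). -/
theorem W1.osPackage {G : Type} [Group G] [TopologicalSpace G] [IsTopologicalGroup G]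
    [CompactSpace G] [MeasurableSpace G] [BorelSpace G] {r : LatticeRep G}
    {sch : SpeciesScheme (YMSpecies G)} {S₁ : SchwingerFamily E4} (h : W1 G r sch S₁) :
    OSPackage S₁ := by
  obtain ⟨-, hOS, htr, hrot, Δ, hΔ, hgap, -⟩ := h
  exact ⟨hOS, htr, hrot, Δ, hΔ, hgap⟩

/-- Reflection positivity in pull-back form for the eight frames `R e₀ ∈ {±e₀, ±e₁, (±e₀±e₁)/√2}`
(what `DiagonalMirrorRPR` + `W₁` would give; the hypothesis of `NPointIsotropy`/`KernelTransfer`). -/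
def SixteenMirrorRP (S₁ : SchwingerFamily E4) : Prop :=
  ∀ (R : E4 ≃ₗᵢ[ℝ] E4) (a b : ℝ), a ^ 2 + b ^ 2 = 1 → (a = 0 ∨ b = 0 ∨ a ^ 2 = b ^ 2) →
    R (EuclideanSpace.single 0 1) = a • EuclideanSpace.single 0 1 + b • EuclideanSpace.single 1 1 →
      (SchwingerFamily.toLabelled (fun n => (S₁ n).comp (linActMulti R))).IsReflectionPositive

/-- The crux with the lattice tie DROPPED (hypothesis = the `S₁`-side package only). -/
def CurvatureKernelBoundWithoutLattice : Prop :=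
  ∀ S₁ : SchwingerFamily E4, OSPackage S₁ → KernelConclusion S₁

/-- … and with reflection positivity across all sixteen `W(B₄)` mirrors ADDED. -/
def CurvatureKernelBoundWithoutLatticeSixteen : Prop :=
  ∀ S₁ : SchwingerFamily E4, OSPackage S₁ → SixteenMirrorRP S₁ → KernelConclusion S₁

/-- The sixteen-mirror version implies the plain one's conclusion pattern (monotonicity, for the
record: a refutation of the sixteen-mirror version refutes both). -/
theorem withoutLattice_of_withoutLatticeSixteen_false
    (h : ¬ CurvatureKernelBoundWithoutLatticeSixteen) : ¬ CurvatureKernelBoundWithoutLattice :=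
  fun h' => h fun S₁ hOS _ => h' S₁ hOS

/-- **NEAR-MISS (any proof of the crux must use the lattice clause for the ORDER).**
`¬ CurvatureKernelBoundWithoutLatticeSixteen`: the OS package E0–E4, E0', translations, proper
signed permutations, a mass gap AND reflection positivity across all sixteen mirrors do not bound
the order of the two-point singularity.

BLUEPRINT (checked by hand + exact arithmetic, `scratch/deriv8.py` of the seat folder).
Witness: the centred Gaussian (generalised free) family `S^C` on `ℝ⁴` with covariance
`Ĉ(k) = P(k)/(k² + m²)`, `m > 0`, `P(k) = (Σ_μ k_μ⁴)²` (for the plain version `P(k) = Σ_μ k_μ⁸`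
already works). (1) `Ĉ ≥ 0` is a tempered symbol, so `S^C` exists (Minlos/Wick; all `Sₙ` are
Gaussian moments, `S_{2j+1} = 0`). (2) OS package: E0 trivial; E0' from Wick (`|Sₙ(F)| ≤ (n-1)!!
Cⁿ |F|_{n s}`); E3 trivial; translations trivial; `W(B₄)`-invariance (all signed permutations,
improper included) because `P` is `W(B₄)`-invariant; E2 across the mirror `⊥ n` for a Gaussian
family ⟸ RP of the covariance on positive-`n`-time test functions ⟺ (residue in `k_n` at
`k_n = iω`, `ω² = k_⊥² + m²`; the polynomial part of `P/(k_n²+ω²)` is a contact term invisible on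
supports strictly inside the half-space) `P(iω n + k_⊥) ≥ 0` on the shell: for `n = e_ν`,
`p₄(iω, k_⊥) = ω⁴ + Σ_⊥ k⁴ > 0`; for `n = (e₀ - e₁)/√2`, `k₀ = conj k₁` on the shell so
`k₀⁴ + k₁⁴ = 2 Re k₀⁴ ∈ ℝ` and `P = p₄² ≥ 0` (for `P = p₈` the diagonal shells FAIL: `2 Re k₀⁸ < 0`
at `arg k₀ = 3π/8` — consistent, `W₁` has no diagonal mirror); E4 and `HasMassGap m'` (any
`m' < m`) from `|∂^α C(x)| ≤ C_α e^{-m'|x|}` (`|x| ≥ 1`) and Gaussian factorisation of truncated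
functions. (3) Violation: the two-point kernel off `0` is `K = P(∂) G_m`, smooth on `ℝ⁴ ∖ 0`; by
§C (`kernelConclusion_iff_of_represents`) the conclusion holds iff `K` itself obeys
`|K x| ≤ C(1 + ‖x‖^(η-10))`; but `G_m = (4π²|x|²)⁻¹ + (m²/8π²) log|x| · (1 + o(1)) + C^∞`, so
`K(x) = P(∂)(4π²|x|²)⁻¹ + O(|x|⁻⁸ log)` and `P(∂)|x|⁻²` is homogeneous of degree `-10` with
`(p₄(∂))² |x|⁻² (e₁) = 940032`, `p₈(∂)|x|⁻²(e₁) = 483840 = 12 · 8!` (both `≠ 0`; the angular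
factors change sign, e.g. `< 0` at `(1,2,0,0)`, and have zero spherical mean since the `O(4)`
average of `P` is a multiple of `Δ⁴`, `Δ|x|⁻² = 0` off `0`): `|K(t e₁)| ≍ t⁻¹⁰`, i.e. `η = 0`
exactly — forbidden. Equivalently, by §B with `F(x,y) = χ(x+y) ρ(x-y)`, `ρ ≥ 0` a bump at `e₁`:
`s² S₂(F_s) → (4π²)⁻¹ 2⁻⁴ χ̂(0) ⟨P(∂)|·|⁻², ρ⟩ ≠ 0`.
OBSTRUCTION (why sorried): the tree has the free field only measure-side (`IsFreeField`,
`IsOSMeasure`, `freeCovarianceReal`, `fourier_freeKernel`, `IsFreeField.isOS3ReflectionPositive`)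
and no `SchwingerFamily`-level `⁰𝒮` package (E0', finite-list E2, E4, all-`(n,m)` `HasMassGap`)
for Gaussian families with covariance `P(∂)G_m`; supplying it is Wick's theorem on `𝓢((ℝ⁴)ⁿ, ℂ)`
plus RP/cluster transfer (est. 3–5 kloc). TRIED: cycle 1 (`ψ = (Σ∂⁴)φ_m`, blocked at the same
point), cycle 2: the ORDER violation is now a Lean theorem at the two-point level for the plain
witness (`TL8_not_representable`, §I: `T₀ ∘ L₈` has no kernel with the crux's bound, unconditionally);
what remains (residue R3) is the package of the Gaussian family (all `n`). CYCLE 3 STATUS: the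
two-point-level analogues are DONE and much stronger (`DisproofIII.lean`: §J ℓ¹ witness with the full
two-point package; §K dimension-5 GFF with full `O(4)` and E2 in EVERY frame — so the SIXTEEN version
holds at the two-point level too). R3 BLUEPRINT (family level, witness = the centred Gaussian family of
the ℓ¹ kernel `K = k₁(‖·‖₁)`, written through permutations: `S_n F = wickNorm n · Σ_{σ∈Sₙ} ∫ ∏_{i<n/2}
K(x_{σ(2i)} − x_{σ(2i+1)}) F`, `wickNorm n = (2^{n/2}(n/2)!)⁻¹` for even `n`, `0` for odd; landed/ready
infrastructure in the Negative lane: `FlatN.norm_le_flat` (flatness at every partial diagonal),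
`Wick.norm_wickW_mul_le` / `Wick.S` (domination on `⁰𝒮ₙ`, Hahn–Banach extension), `Wick.S_permTest` /
`S_translateMulti` / `S_linActMulti` / `S_hermitian`). REMAINING: (i) no-cross factorisation
`S_{n+m}(ΘF*⊗G) − S_n(ΘF*)S_m(G) = wickNorm(n+m)·Σ_{σ with a cross pair} ∫ wickW σ·H` via the bijection
(slot subsets × Sₙ × Sₘ) ↔ no-cross permutations and `wickNorm(n+m)·C((n+m)/2, n/2) = wickNorm n ·
wickNorm m`, giving E4 and `HasMassGap 1` (each cross factor `≤ B e^{-t}(1+K)`); (ii) E2 at family level: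
group permutations by the number `c` of cross pairs and ordered enumerations `e : Fin c ↪ block` (factor
`1/c!`), insert the feature map `K(θa − b) = ∫_Ω w ψ_ω(a)ψ_ω(b) dω` (`L1RPKernel.integral_w_psi_psi`) to
get `Σᵢⱼ c̄ᵢcⱼ S(ΘFᵢ*⊗Fⱼ) = Σ_c (c!)⁻¹ ∫_{Ω^c} w^{⊗c} |Σⱼ cⱼ Ãⱼ^c(ω)|² dω ≥ 0`; (iii) E0' from
`norm_wick_le` (`σ_n = n!·Cbn ≤ α (n!)^β`, `schwartzNorm (n·5) ≥ SNn (4n+1) (5n)`); (iv) `S 0 := eval`,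
`S 1 := 0`, assembly. Estimated 2–3 kloc. -/
theorem not_curvatureKernelBound_without_lattice_sixteen :
    ¬ CurvatureKernelBoundWithoutLatticeSixteen := by
  sorry

/-- **NEAR-MISS** (corollary shape of the previous one; witness `P = Σ_μ k_μ⁸` suffices here,
axis mirrors only). -/
theorem not_curvatureKernelBound_without_lattice : ¬ CurvatureKernelBoundWithoutLattice :=
  withoutLattice_of_withoutLatticeSixteen_false not_curvatureKernelBound_without_lattice_sixteen

end WithoutLattice

/-! ## §E Targets — line `sixteen-charts-analytic-kernel` (PICKED 2026-08-16T00:10Z; skeleton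
`Lines/sixteen-charts-analytic-kernel.lean` read at 00:23Z; payload.targets still `[]`, so this is the disprover's
own pass over the 7 registered stubs). VERDICT: 0 broken, 0 mis-typed; the line is consistent with every finding of
this file (kernel typed `ℂ`-valued — triage G1; ORDER asserted only in `AxialGrowth` — §B/§D/§I; pinning used — §C).
Per stub (cheap arsenal: degenerate inhabitants, the dressed-free witnesses `TL8`/§D, v4's AxisCross, typing):
* `Stub.DiagonalMirrorRPR` — the route's own item stmt-QuantumFields-10604 (not attacked here).
* `Stub.ChartDerivativeBounds` (A1) — TRUE-looking (OS contraction semigroup in the frame: `e^{-δH}Hᴺ ≤ (N/eδ)ᴺ`,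
  vector norms by ONE Schwartz order from temperedness of `S₁ 2`); degenerate/Gaussian witnesses satisfy it; note the
  bound is only claimed for supports on opposite sides of the mirror through the ORIGIN — consistent with translation
  invariance being a hypothesis. No cheap attack.
* `Stub.TensorRegularity` (A2) — TRUE-looking pure analysis (pure derivatives along 4+4 spanning directions of order
  `N₁ > 2M₀ + 9` in a FIXED order `M₀` ⇒ local bounded continuous kernel; tensors suffice by plane waves/nuclearity);
  `ρ` is existential so the box can be kept inside `U × V` — no junk `Λ` bites. No cheap attack.
* `Stub.KernelOffDiagonal` (A3) — implication (A1 → A2 → …); conclusion true on all witnesses of this file (`TL8`-type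
  kernels `p₈(∂)G_m` are continuous off `0` with `‖K‖ ≤ A(‖x‖¹⁰ + ‖x‖⁻¹⁰)`; vacuum `K = 0`; v4's AxisCross is excluded by
  the diagonal-frame hypothesis). RISK (proof, not statement): the polynomial a-priori bound needs A1 applied ONCE and
  transported to the dilates `S₁ ∘ D_λ` by explicit seminorm scaling (applying A1 to each dilate gives λ-dependent
  `M₀, C, p`), plus compactness of the direction sphere for A2's `B` — as the skeleton's docstring (vi) says.
* `Stub.OffDiagonalExtension` (A4) — TRUE-looking (uniform flatness of `⁰𝒮` on the diagonal from Schwartz bounds;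
  cut-offs converge in `𝓢`). No cheap attack.
* `Stub.AxisEnvelope` (B) — TRUE-looking; (a),(c) are Gram minors + `K(−x) = K(x)` from `R = −1 ∈ SO(4)`; (b)
  antitonicity genuinely needs temperedness/OS contraction (RP alone allows `k(s) = e^{+s}`: rank-one PSD Hankel
  kernel) — the skeleton says so. `‖ξ‖ ≤ 2 max_μ |ξ^μ|` is exactly dimension 4 (tight at `(1,1,1,1)`).
* `Stub.AxialGrowth` (E) — OPEN; it is a CONSEQUENCE of the crux (pinning `kernel_unique` + `η' = min(η,10)`), so it
  cannot be refuted without refuting the crux; `TL8` (§I) and the §D Gaussians are NOT `W₁`-inhabitants (no lattice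
  tie) and fail exactly here, as designed. The disprover's standing offer for E: any proposed proof that does not use
  `W₁.1` beyond reality is refuted by `TL8_not_representable` once the package clauses of `TL8` are supplied (R3). -/

end Summit.QuantumFields.YangMills.Cruxes.CurvatureKernelBound.Disproof
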